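import Mathlib
import Literature.Combinatorics.Optimization.SDPRelaxationsMaxCSP
import Literature.Analysis.Convex.LinearProgrammingDuality
import HarnessLib

/-!
# LP relaxations of Max-CSPs versus Sherali–Adams, and the nonnegative rank of pattern matrices
# (Kothari–Meka–Raghavendra 2017/2022, §1 with §3.3)

LP-side companion of `SDPRelaxationsMaxCSP.lean` (Lee–Raghavendra–Steurer's SDP/sum-of-squares
results, whose Boolean Max-CSP vocabulary `CSPConstraint`, `CSPInstance`, `CSPInstance.val`,
`CSPInstance.OptLE`, `maxCutPreds`, `maxThreeSatPreds` and cube vocabulary `cubeExpect`,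
`HasDegreeLE` are reused).  This file TYPES the general-LP-versus-Sherali–Adams theorem of
Kothari–Meka–Raghavendra, its CSP corollaries and its engine (nonnegative rank of pattern matrices
versus nonnegative junta degree): the model as real definitions, the printed theorems as cited
NAMED FACTS (`def … : Prop`, not proved here; D-0014).

Source: P. K. Kothari, R. Meka, P. Raghavendra, *Approximating rectangles by juntas and
weakly-exponential lower bounds for LP relaxations of CSPs*, STOC 2017, 590–603
[KothariMekaRaghavendra2017] = SIAM J. Comput. 51 (2) (2022), STOC17-305–332
[KothariMekaRaghavendra2021]; held text `paper:arxiv-1610.02704` (arXiv rendering, latest version;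
locators "Thm n (p. N)" = numbers and pages of that rendering).  Typed for the pnp-psdrank cell
(ladder FRONTIER rung F-N2; LP-side context of crux `TracialDecayExp20`, stmt-PneNP-19878: the
nonnegative-rank lifting at EXPONENTIAL strength whose psd analogue is not in print).

## Printed statements (verbatim up to notation) and how they are rendered

* §1.1 (p. 3): "A MAX-CSP … is defined by a predicate `P : {−1,1}^k → {0,1}`. An instance `ℑ` is
  defined by a collection of `k`-tuples of literals `C_1,…,C_m` on `n` Boolean variables … maximize
  the number of satisfied constraints `opt(ℑ) = max_x Σ_i P(C_i(x)) ≡ max_x ℑ(x)`. … MAX-CUT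
  corresponds to the case where `P(a,b) = (1−ab)/2` with instances corresponding to graphs."
  — RENDERING: `{−1,1}` is relabelled `{0,1}` (`Bool`); an instance of CSP(`P`) with literals is an
  instance (sibling file's `CSPInstance`, predicates applied to DISTINCT variables — the convention
  of [ChanEtAl2016]/[LeeRaghavendraSteurer2015] which this paper follows, §1.1 "framework
  introduced in [CLRS13]") of Max-`literalClosure P`, the set of sign-flipped copies of `P`; the
  objective is the FRACTION of satisfied constraints (the paper's `(c,s) ∈ (0,1]` and
  "`P_ℑ : {−1,1}ⁿ → [0,1]` such that `P_ℑ(x) = ℑ(x)`", §3.3 p. 9, presuppose this normalisation);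
  MAX-CUT is Max-`maxCutPreds` (the inequality predicate, instances = multigraphs).
* **Definition 1.1** (p. 3, linearization / LP relaxation): "A vector `v_x ∈ ℝ^D` for every
  `x ∈ {−1,1}ⁿ`. A vector `w_ℑ ∈ ℝ^D` for every instance `ℑ` of the CSP. For every assignment `x` and
  every instance `ℑ`, `ℑ(x) = ⟨w_ℑ, v_x⟩`. … For a polytope `𝒫 ⊆ ℝ^D` with `{v_x} ⊆ 𝒫`, we look at
  the linear program `opt_𝒫(ℑ) = max_{y ∈ 𝒫} ⟨w_ℑ, y⟩`. … The complexity or size of the relaxation is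
  defined as the number of facets (or inequalities) needed to describe the polytope `𝒫`. … For
  `0 < c ≤ s ≤ 1` [sic; `0 < s < c ≤ 1`, Lemma 7.1 p. 20], we say `𝒫` achieves a
  `(c,s)`-approximation … if for `n`-variable instances `ℑ` with `opt(ℑ) ≤ s`, `opt_{𝒫_n}(ℑ) ≤ c`.
  Similarly, for `0 ≤ α ≤ 1`, we say `𝒫` achieves an `α`-approximation if …
  `opt(ℑ) ≥ α · opt_{𝒫_n}(ℑ)`. In the latter case, we also say `𝒫` has integrality-gap at most
  `1/α`."  — `LPRelaxation k n 𝒫 R` (a linearization together with a BOUNDED polyhedron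
  `{y | A y ≤ b}` described by `R` inequalities containing every `v_x`; "size at most `R`"),
  `LPRelaxation.Achieves` (`(c,s)`), `LPRelaxation.AchievesRatio` (`opt_𝒫(ℑ) ≤ ρ · opt(ℑ)`, i.e.
  integrality gap at most `ρ`), `CSPInstance.opt`.
* **Definition 3.3** (p. 9, Sherali–Adams): "A degree `d` Sherali–Adams pseudoexpectation `Ẽ` is a
  linear operator on the space of degree at most `d` polynomials `P_d^n` such that: for every
  non-negative `p ∈ P_d^n` that depends on only `d` variables, `Ẽ[p] ≥ 0`, and `Ẽ[1] = 1`. … the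
  degree `d`-Sherali–Adams relaxation is `max_Ẽ Ẽ[P_ℑ(x)]` … We define `SA_d(ℑ)` as the value."
  — `SAPseudoexpectation n d` (RENDERING: the functional is taken on ALL real functions on `{0,1}ⁿ`;
  its constraints and the objective `ℑ` involve only functions of degree `≤ d` once `d ≥ k`, so for
  `d ≥ k` — the only case in which `SA_d(ℑ)` is defined in print — `SA_d(ℑ) ≤ c` is exactly
  `SAAchieves` below; the typed theorems carry the guard `k ≤ d`), `SAAchieves 𝒫 d c s`
  ("the `d`-round Sherali–Adams relaxation achieves a `(c,s)`-approximation on `n`-variable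
  instances"; rounds = degree, as the paper uses both words for the same object, Thm 1.2 vs Thm 1.4).
* **Theorem 1.2** (p. 3): "There exist constants `0 < h < H` such that the following holds. Consider
  a function `f : ℕ → ℕ`. Suppose that the `f(n)`-round Sherali–Adams relaxation for a CSP cannot
  achieve a `(c,s)`-approximation on instances on `n` variables. Then, no LP relaxation of size at
  most `n^{h f(n)}` can achieve a `(c,s)`-approximation for the CSP on `n^H` variables."
  — `KothariMekaRaghavendra2017_thm12`, with `H ∈ ℕ` (proof, p. 20: "for some constants
  `h, H ∈ ℕ`"; `n^H` must be a number of variables), `0 < s < c ≤ 1` (Lemma 7.1) and the guard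
  `k ≤ f(n)`.  Recorded caveat (not a change of the typed statement): the printed proof (p. 20)
  delivers the conclusion for `(c − 1/n, s)`-approximation (the shift `η = 1/n` of Lemma 2.4); the
  fact is typed AS PRINTED.
* **Definition 1.6** (p. 4): "`nnr(M)` is the least positive integer `r` such that there exist
  non-negative rank-1 matrices `M_1,…,M_r` with `M = Σ M_i`" — `HasNonnegFactorization M r`
  (`M_{ij} = Σ_{l<r} U_{il} V_{lj}`, `U, V ≥ 0`; "`nnr(M) ≥ X`" reads "no such factorisation of size
  `r < X`").
* **Definition 1.7** (p. 4, pattern matrix): "`f ∘ g^{⊗n}(x,y) = f(g(x_1,y_1),…,g(x_n,y_n))` …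
  `M_f^g(x,y) = f ∘ g^{⊗n}(x,y)`, rows and columns indexed by `[q]ⁿ` … we will set `q = 2^b`,
  identify `[q]` with `{0,1}^b` and define `IP(x,y) = (−1)^{x_1 ⊕ y_1} · (−1)^{⊕_i x_i y_i}` … we
  use `M_f^b` to denote the pattern matrix `M_f^{IP}`" — `ipGadget b`, `ipPatternMatrix b f`
  (the Boolean `x_1 ⊕ y_1 ⊕ ⊕_i x_i y_i`, `true` ↔ `−1`).
* **Definitions 1.8/1.9** (p. 4): "`h : {−1,1}ⁿ → ℝ` is a `d`-junta if it only depends on at most `d`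
  coordinates. `h ≥ 0` is a conical `d`-junta if it can be written as a non-negative linear
  combination of non-negative `d`-juntas. … `deg_+(f)` is the least positive integer `d` such that
  `f` can be written as a conical `d`-junta." — `IsJunta`, `IsConicalJunta`, `nonnegDegree` (an
  infimum over `ℕ`, so `deg_+(const) = 0`: with the printed "least positive integer" the theorem
  would fail for constant `f`, `nnr = 1`), and `cubeDegree` for "`deg(f)`, the degree of `f` as a
  polynomial" (multilinear degree, via the tree's `HasDegreeLE`).
* **Theorem 1.10** (p. 5, `nnr(M_f)` vs `deg_+(f)`): "There exist constants `c, C > 0` such that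
  the following holds. Let `f : {−1,1}ⁿ → ℝ_{≥0}` be such that `E[f] = 1`. Then
  `nnr(M_f^b) ≥ 2^{c·b·(deg_+(f+η) − 8 deg(f))}` for all `η ≥ 1/n` and `b ≥ C log n`."
  (logarithms base 2, footnote p. 7) — `KothariMekaRaghavendra2017_thm110`, with the recorded
  guard `b ≥ 1` (`q = 2^b ≥ 2`; at `n = 1`, `b = 0` the printed sentence fails for `f = 2·𝟙_{−1}`).
* **Corollary 1.5** (p. 4): "For some universal constant `H ≥ 1`, for every `ε > 0`, there exist
  constants `c_1(ε), c_2(ε), c_3(ε)` such that the following hold: no LP relaxation of size less than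
  `2^{c_1(ε) n^{1/H}}` has integrality gap less than `8/7 − ε` for MAX-3SAT; no LP relaxation of size
  less than `2^{c_2(ε) n^{1/H}}` has integrality gap less than `2 − ε` for MAX-3XOR; no LP
  relaxation of size less than `2^{n^{c_3(ε)}}` has integrality gap less than `2 − ε` for MAX-CUT."
  — `KothariMekaRaghavendra2017_cor15_threeSat / _threeXor / _maxCut`; "has integrality gap less
  than `ρ`" = achieves ratio `ρ'` for some `ρ' < ρ` (sup reading); each with a threshold `n ≥ n₀(ε)`
  (recorded repair: for `n ≤ 2` there are no MAX-3SAT/3XOR instances on distinct variables, and the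
  proof, p. 21, produces `N = n^H`).

PROVED at the end of the file (appended): the direction "LP relaxation of size `R` achieving `(c,s)` ⇒
nonnegative factorisation of `M^{n,Π}_{c,s}` of size `R + 1`" of the [CLRS13]/Yannakakis characterisation
(Fact 7.2), by LP duality (`Literature.Analysis.Convex.LPDuality.affine_farkas`).

Also PROVED (second append): **Lemma 7.3** ("`M_f^g` is a sub-matrix of `𝓜_{q·n,s}`": planting `ℑ*`
along `y ∈ [q]ⁿ`, gadget assignments `x̃`; `HasNonnegFactorization.ipPatternMatrix_of_cspMatrix`) and
hence **Lemma 7.1** in the explicit form "an LP relaxation of size `R` achieving `(c,s)` on `n·2^b`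
variables gives `nnr(M_f^b) ≤ R + 1`" (`LPRelaxation.Achieves.hasNonnegFactorization_ipPatternMatrix`);
so of the proof of Thm 1.2 (p. 20) exactly Thm 1.10 (typed) and Fact 3.4 ([CLRS13]) remained unproved
after that append.

Also PROVED (third append): **Fact 3.4** = [ChanEtAl2016, eq. (1.2)], the LP duality "`SA_d(ℑ) ≤ c` iff
`c − ℑ` is a conical `d`-junta (`deg_+(c − ℑ) ≤ d`)" (`SAPseudoexpectation.forall_le_iff_isConicalJunta`,
`KothariMekaRaghavendra2017_fact34`), with the junta/`deg_+` API it needs; so of the printed proof of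
Thm 1.2 exactly Thm 1.10 remains unproved here.

Also PROVED (fourth append): **Theorem 1.2 assembled from Theorem 1.10**, in the form the printed proof
(p. 20) delivers — `KothariMekaRaghavendra2017_thm12_of_thm110 : KothariMekaRaghavendra2017_thm110 → …`
(conclusion for `(c − 1/n, s)`, guards `1/n < c − s`, `f(n) ≥ 16k`, `n ≥ n₀`; see its docstring), with
the bookkeeping it needs: `deg(ℑ) ≤ k` (`CSPConstraint.hasDegreeLE_sat`, `CSPInstance.hasDegreeLE_val`,
`HasDegreeLE.add/.sub/.const_mul/.sum`), linearity of `E_x` (`cubeExpect_const/_const_mul/_const_sub`),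
scale invariance (`nonnegDegree_const_mul`, `HasNonnegFactorization.const_mul`) and padding
(`LPRelaxation.restrict`: an LP relaxation for `n'`-variable instances restricts to `N ≤ n'` variables).

Not typed: Thm 1.3/1.4 = 7.4/7.5 (Sherali–Adams gaps of [CharikarMM09], [Gri01, Schoenebeck08,
BGMT12] — third-party inputs), the "⇐" half of Fact 7.2 (nonnegative factorisation ⇒ LP relaxation;
not needed for lower bounds — the printed construction, [ChanEtAl2016] Thm 2.3, is a cone, not a
polytope), Thm 1.11 (the
"explicit matrix" separation; quantification over `N` not printed precisely), and the junta
approximation theorem Thm 2.7 = 5.5 (the held arXiv rendering prints it with three mutually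
inconsistent parameter sets, Thm 2.7 / Thm 5.5 / Lemma 5.6 "what is proven in this section right now
is the following weaker form"; to be typed from the SIAM J. Comput. text).
-/

noncomputable section

open Finset Matrix

namespace Literature.Combinatorics.Optimization

/-! ### CSPs defined by one predicate with literals; MAX-3SAT, MAX-3XOR -/

/-- The **literal closure** of a predicate `P : {0,1}^k → {0,1}`: the predicates
`y ↦ P(y ⊕ σ)`, `σ ∈ {0,1}^k` (apply `P` to a `k`-tuple of literals).  An instance of "CSP(`P`)"
in the sense of Kothari–Meka–Raghavendra is an instance of Max-`literalClosure P`.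
[cite: KothariMekaRaghavendra2017, §1.1 (p. 3: "a collection of k-tuples of literals")] -/
def literalClosure {k : ℕ} (P : (Fin k → Bool) → Bool) : Set ((Fin k → Bool) → Bool) :=
  Set.range fun σ : Fin k → Bool => fun y => P fun j => xor (y j) (σ j)

/-- The 3-ary disjunction `y_0 ∨ y_1 ∨ y_2`; MAX-3SAT = CSP(`or₃`) with literals.
[cite: KothariMekaRaghavendra2017, §1 (p. 3)] -/
def orThree : (Fin 3 → Bool) → Bool := fun y => y 0 || y 1 || y 2

/-- The 3-ary parity predicate `y_0 ⊕ y_1 ⊕ y_2` ("`x_i x_j x_k = −1`" in `±1` notation); MAX-3XOR =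
CSP(`xor₃`) with literals. [cite: KothariMekaRaghavendra2017, §1 (p. 3)] -/
def xorThree : (Fin 3 → Bool) → Bool := fun y => xor (xor (y 0) (y 1)) (y 2)

/-- `opt(ℑ) = max_{x} ℑ(x)`. [cite: KothariMekaRaghavendra2017, eq. (1.1) (p. 3)] -/
def CSPInstance.opt {k n : ℕ} {P : Set ((Fin k → Bool) → Bool)} (I : CSPInstance k n P) : ℝ :=
  univ.sup' univ_nonempty I.val

/-! ### LP relaxations of a Max-CSP (Definition 1.1) -/

/-- **An LP relaxation of size (at most) `R` for Max-`𝒫` on `n` variables** (KMR Def. 1.1 = the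
[ChanEtAl2016] model): a linearization `v_x, w_ℑ ∈ ℝ^D` with `ℑ(x) = ⟨w_ℑ, v_x⟩` for EVERY instance
and assignment, and a polytope `𝒫 = {y ∈ ℝ^D | A y ≤ b}` described by `R` linear inequalities,
bounded, containing every `v_x`; its value on `ℑ` is `opt_𝒫(ℑ) = max_{y ∈ 𝒫} ⟨w_ℑ, y⟩`.
[cite: KothariMekaRaghavendra2017, Def. 1.1 (p. 3)] -/
structure LPRelaxation (k n : ℕ) (P : Set ((Fin k → Bool) → Bool)) (R : ℕ) where
  /-- dimension of the linearization -/
  D : ℕ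
  /-- `v_x ∈ ℝ^D` -/
  v : (Fin n → Bool) → Fin D → ℝ
  /-- `w_ℑ ∈ ℝ^D` -/
  w : CSPInstance k n P → Fin D → ℝ
  /-- `ℑ(x) = ⟨w_ℑ, v_x⟩` -/
  exact : ∀ (I : CSPInstance k n P) (x : Fin n → Bool), I.val x = w I ⬝ᵥ v x
  /-- the `R` inequalities `A y ≤ b` describing `𝒫` -/
  A : Matrix (Fin R) (Fin D) ℝ
  b : Fin R → ℝ
  /-- `v_x ∈ 𝒫` -/
  mem : ∀ (x : Fin n → Bool) (i : Fin R), (A *ᵥ v x) i ≤ b i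
  /-- `𝒫` is a polytope (bounded) -/
  bounded : Bornology.IsBounded {y : Fin D → ℝ | ∀ i, (A *ᵥ y) i ≤ b i}

namespace LPRelaxation

variable {k n R : ℕ} {P : Set ((Fin k → Bool) → Bool)}

/-- The polytope `𝒫 = {y | A y ≤ b}` of the relaxation. [cite: KothariMekaRaghavendra2017, Def. 1.1 (p. 3)] -/
def polytope (L : LPRelaxation k n P R) : Set (Fin L.D → ℝ) := {y | ∀ i, (L.A *ᵥ y) i ≤ L.b i}

/-- "`opt_𝒫(ℑ) ≤ c`": every `y ∈ 𝒫` has `⟨w_ℑ, y⟩ ≤ c`. [cite: KothariMekaRaghavendra2017, Def. 1.1 (p. 3)] -/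
def ValueLE (L : LPRelaxation k n P R) (I : CSPInstance k n P) (c : ℝ) : Prop :=
  ∀ y ∈ L.polytope, L.w I ⬝ᵥ y ≤ c

/-- **`𝒫` achieves a `(c,s)`-approximation** on `n`-variable instances: `opt(ℑ) ≤ s ⟹ opt_𝒫(ℑ) ≤ c`.
[cite: KothariMekaRaghavendra2017, §1.1 (p. 3)] -/
def Achieves (L : LPRelaxation k n P R) (c s : ℝ) : Prop :=
  ∀ I : CSPInstance k n P, I.OptLE s → L.ValueLE I c

/-- **`𝒫` achieves approximation ratio `ρ`** (integrality gap at most `ρ = 1/α`):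
`opt_𝒫(ℑ) ≤ ρ · opt(ℑ)` for every instance ("`opt(ℑ) ≥ α · opt_𝒫(ℑ)`").
[cite: KothariMekaRaghavendra2017, §1.1 (p. 3)] -/
def AchievesRatio (L : LPRelaxation k n P R) (ρ : ℝ) : Prop :=
  ∀ I : CSPInstance k n P, L.ValueLE I (ρ * I.opt)

/-- "Has integrality gap less than `ρ`": achieves some ratio `ρ' < ρ`.
[cite: KothariMekaRaghavendra2017, Cor. 1.5 (p. 4)] -/
def GapLT (L : LPRelaxation k n P R) (ρ : ℝ) : Prop := ∃ ρ' : ℝ, ρ' < ρ ∧ L.AchievesRatio ρ'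

end LPRelaxation

/-! ### Sherali–Adams pseudoexpectations (Definition 3.3) -/

/-- `h : {0,1}ⁿ → ℝ` is a **`d`-junta**: it depends on at most `d` coordinates.
[cite: KothariMekaRaghavendra2017, Def. 1.8 (p. 4)] -/
def IsJunta {n : ℕ} (d : ℕ) (h : (Fin n → Bool) → ℝ) : Prop :=
  ∃ S : Finset (Fin n), S.card ≤ d ∧ ∀ x y : Fin n → Bool, (∀ i ∈ S, x i = y i) → h x = h y

/-- A **degree-`d` Sherali–Adams pseudoexpectation** on `n` variables: a linear functional `Ẽ` on
real functions on `{0,1}ⁿ` with `Ẽ[p] ≥ 0` for every nonnegative `d`-junta `p` and `Ẽ[1] = 1`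
(printed on polynomials of degree `≤ d`; see the module docstring for the extension to all
functions). [cite: KothariMekaRaghavendra2017, Def. 3.3 (p. 9)] -/
structure SAPseudoexpectation (n d : ℕ) where
  /-- the functional `Ẽ` -/
  E : ((Fin n → Bool) → ℝ) →ₗ[ℝ] ℝ
  nonneg : ∀ p : (Fin n → Bool) → ℝ, IsJunta d p → (∀ x, 0 ≤ p x) → 0 ≤ E p
  map_one : E (fun _ => 1) = 1

/-- **The degree-`d` (= `d`-round) Sherali–Adams relaxation achieves a `(c,s)`-approximation on
`n`-variable instances of Max-`𝒫`**: `opt(ℑ) ≤ s ⟹ SA_d(ℑ) ≤ c`, where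
`SA_d(ℑ) = max_Ẽ Ẽ[ℑ]` over degree-`d` pseudoexpectations; "cannot achieve" is the negation
(some `ℑ` with `opt(ℑ) ≤ s` and some `Ẽ` with `Ẽ[ℑ] > c`).
[cite: KothariMekaRaghavendra2017, eq. (3.1) and Thm 1.2 (pp. 9, 3)] -/
def SAAchieves {k n : ℕ} (P : Set ((Fin k → Bool) → Bool)) (d : ℕ) (c s : ℝ) : Prop :=
  ∀ I : CSPInstance k n P, I.OptLE s → ∀ pE : SAPseudoexpectation n d, pE.E I.val ≤ c

/-! ### Nonnegative rank, pattern matrices, conical juntas (Definitions 1.6–1.9) -/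

/-- `M` has a **nonnegative factorisation of size `r`**: `M = Σ_{l<r} u_l v_lᵀ` with `u_l, v_l ≥ 0`
(a sum of `r` nonnegative rank-one matrices); `nnr(M)` is the least such `r`.
[cite: KothariMekaRaghavendra2017, Def. 1.6 (p. 4)] -/
def HasNonnegFactorization {ι κ : Type*} (M : ι → κ → ℝ) (r : ℕ) : Prop :=
  ∃ (U : ι → Fin r → ℝ) (V : Fin r → κ → ℝ), (∀ i l, 0 ≤ U i l) ∧ (∀ l j, 0 ≤ V l j) ∧
    ∀ i j, M i j = ∑ l, U i l * V l j

/-- The **inner-product gadget** `IP : {0,1}^b × {0,1}^b → {±1}`,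
`IP(x,y) = (−1)^{x_1 ⊕ y_1} · (−1)^{⊕_i x_i y_i}`, as the Boolean `x_1 ⊕ y_1 ⊕ ⊕_i (x_i ∧ y_i)`
(`true` ↔ `−1`; for `b = 0` the first term is absent). [cite: KothariMekaRaghavendra2017, Def. 1.7 (p. 4)] -/
def ipGadget (b : ℕ) (x y : Fin b → Bool) : Bool :=
  xor (if h : 0 < b then xor (x ⟨0, h⟩) (y ⟨0, h⟩) else false)
    (univ.filter fun i => x i && y i).card.bodd

/-- **The pattern matrix `M_f^b`** of `f : {0,1}ⁿ → ℝ` with the gadget `IP` on `b` bits: rows and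
columns indexed by `({0,1}^b)ⁿ`, entry `f(IP(x_1,y_1),…,IP(x_n,y_n))`.
[cite: KothariMekaRaghavendra2017, Def. 1.7 (p. 4)] -/
def ipPatternMatrix {n : ℕ} (b : ℕ) (f : (Fin n → Bool) → ℝ) :
    (Fin n → Fin b → Bool) → (Fin n → Fin b → Bool) → ℝ :=
  fun x y => f fun i => ipGadget b (x i) (y i)

/-- `f ≥ 0` is a **conical `d`-junta**: a nonnegative linear combination of nonnegative `d`-juntas.
[cite: KothariMekaRaghavendra2017, Def. 1.8 (p. 4)] -/
def IsConicalJunta {n : ℕ} (d : ℕ) (f : (Fin n → Bool) → ℝ) : Prop :=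
  ∃ (t : ℕ) (lam : Fin t → ℝ) (h : Fin t → (Fin n → Bool) → ℝ),
    (∀ i, 0 ≤ lam i) ∧ (∀ i, IsJunta d (h i)) ∧ (∀ i x, 0 ≤ h i x) ∧
    ∀ x, f x = ∑ i, lam i * h i x

/-- **Nonnegative degree `deg_+(f)`**: the least `d` such that `f` is a conical `d`-junta (infimum
over `ℕ`; `0` for a function that is no conical junta of any degree, which does not happen for
`f ≥ 0`, an `n`-junta). [cite: KothariMekaRaghavendra2017, Def. 1.8/1.9 (p. 4)] -/
def nonnegDegree {n : ℕ} (f : (Fin n → Bool) → ℝ) : ℕ := sInf {d | IsConicalJunta d f}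

/-- **`deg(f)`**, the degree of `f` as a (multilinear) polynomial: the least `d` with
`HasDegreeLE d f`. [cite: KothariMekaRaghavendra2017, Thm 1.10 (p. 5: "deg(f)")] -/
def cubeDegree {n : ℕ} (f : (Fin n → Bool) → ℝ) : ℕ := sInf {d | HasDegreeLE d f}

/-! ### The named facts -/

/-- **Kothari–Meka–Raghavendra 2017, Theorem 1.2 (general LPs are no stronger than Sherali–Adams
for CSPs).** There are constants `0 < h < H` (`H ∈ ℕ`) such that for every predicate
`P : {0,1}^k → {0,1}`, all `0 < s < c ≤ 1`, every `f : ℕ → ℕ` and every `n` with `f(n) ≥ k`: if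
the degree-`f(n)` Sherali–Adams relaxation of CSP(`P`) cannot achieve a `(c,s)`-approximation on
`n`-variable instances, then no LP relaxation of size at most `n^{h f(n)}` achieves a
`(c,s)`-approximation for CSP(`P`) on `n^H` variables.  NOT proved here (proof: Thm 1.10 + Lemma
7.3 + the [CLRS13] characterisation, §7 p. 20, where the conclusion is obtained for
`(c − 1/n, s)`; typed as printed). [cite: KothariMekaRaghavendra2017, Thm 1.2 (p. 3)] -/
def KothariMekaRaghavendra2017_thm12 : Prop :=
  ∃ (h : ℝ) (H : ℕ), 0 < h ∧ h < H ∧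
    ∀ (k : ℕ) (P : (Fin k → Bool) → Bool) (c s : ℝ), 0 < s → s < c → c ≤ 1 →
    ∀ (f : ℕ → ℕ) (n : ℕ), k ≤ f n →
      ¬ SAAchieves (n := n) (literalClosure P) (f n) c s →
      ∀ R : ℕ, (R : ℝ) ≤ (n : ℝ) ^ (h * f n) →
        ∀ L : LPRelaxation k (n ^ H) (literalClosure P) R, ¬ L.Achieves c s

/-- **Kothari–Meka–Raghavendra 2017, Theorem 1.10 (nonnegative rank of pattern matrices versus
nonnegative degree).** There are constants `c, C > 0` such that for every `n ≥ 1`, every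
`f : {0,1}ⁿ → ℝ_{≥0}` with `E[f] = 1`, every `η ≥ 1/n` and every `b ≥ max(1, C log₂ n)`:
`nnr(M_f^b) ≥ 2^{c · b · (deg_+(f + η) − 8 deg(f))}`, i.e. `M_f^b` has no nonnegative factorisation
of size `r < 2^{c b (deg_+(f+η) − 8 deg f)}`.  (Tight up to the constant in the exponent:
`nnr(M_f^b) ≤ C(n, deg_+ f) · 2^{b deg_+ f}`, eq. (1.2).)  NOT proved here (proof: Lemma 2.3
junta approximation of rectangles + Lemma 2.4, §4). [cite: KothariMekaRaghavendra2017, Thm 1.10 (p. 5)] -/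
def KothariMekaRaghavendra2017_thm110 : Prop :=
  ∃ c C : ℝ, 0 < c ∧ 0 < C ∧
    ∀ (n : ℕ), 1 ≤ n → ∀ (f : (Fin n → Bool) → ℝ), (∀ x, 0 ≤ f x) → cubeExpect f = 1 →
    ∀ η : ℝ, 1 / (n : ℝ) ≤ η → ∀ b : ℕ, 1 ≤ b → C * Real.logb 2 n ≤ b →
    ∀ r : ℕ,
      (r : ℝ) < (2 : ℝ) ^ (c * b * ((nonnegDegree (fun x => f x + η) : ℝ) - 8 * cubeDegree f)) →
      ¬ HasNonnegFactorization (ipPatternMatrix b f) r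

/-- **Kothari–Meka–Raghavendra 2017, Corollary 1.5 (MAX-3SAT).** For a universal `H ≥ 1`: for every
`ε > 0` there are `c_1 > 0` and `n₀` such that for all `n ≥ n₀`, no LP relaxation of MAX-3SAT on `n`
variables of size `R < 2^{c_1 n^{1/H}}` has integrality gap less than `8/7 − ε`.  (The same `H`
serves the 3XOR clause, `KothariMekaRaghavendra2017_cor15_threeXor`.)  NOT proved here (Thm 1.2 +
Thm 7.5, p. 21). [cite: KothariMekaRaghavendra2017, Cor. 1.5 (p. 4)] -/
def KothariMekaRaghavendra2017_cor15_threeSat : Prop :=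
  ∃ H : ℝ, 1 ≤ H ∧ ∀ ε : ℝ, 0 < ε → ∃ c₁ : ℝ, 0 < c₁ ∧ ∃ n₀ : ℕ, ∀ n : ℕ, n₀ ≤ n →
    ∀ R : ℕ, (R : ℝ) < (2 : ℝ) ^ (c₁ * (n : ℝ) ^ (1 / H)) →
      ∀ L : LPRelaxation 3 n (literalClosure orThree) R, ¬ L.GapLT (8 / 7 - ε)

/-- **Kothari–Meka–Raghavendra 2017, Corollary 1.5 (MAX-3XOR).** For a universal `H ≥ 1`: for every
`ε > 0` there are `c_2 > 0` and `n₀` such that for all `n ≥ n₀`, no LP relaxation of MAX-3XOR on `n`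
variables of size `R < 2^{c_2 n^{1/H}}` has integrality gap less than `2 − ε`.  NOT proved here.
[cite: KothariMekaRaghavendra2017, Cor. 1.5 (p. 4)] -/
def KothariMekaRaghavendra2017_cor15_threeXor : Prop :=
  ∃ H : ℝ, 1 ≤ H ∧ ∀ ε : ℝ, 0 < ε → ∃ c₂ : ℝ, 0 < c₂ ∧ ∃ n₀ : ℕ, ∀ n : ℕ, n₀ ≤ n →
    ∀ R : ℕ, (R : ℝ) < (2 : ℝ) ^ (c₂ * (n : ℝ) ^ (1 / H)) →
      ∀ L : LPRelaxation 3 n (literalClosure xorThree) R, ¬ L.GapLT (2 - ε)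

/-- **Kothari–Meka–Raghavendra 2017, Corollary 1.5 (MAX-CUT).** For every `ε > 0` there are
`c_3 > 0` and `n₀` such that for all `n ≥ n₀`, no LP relaxation of MAX-CUT on `n` vertices of size
`R < 2^{n^{c_3}}` has integrality gap less than `2 − ε`.  NOT proved here (Thm 1.2 + the
Charikar–Makarychev–Makarychev Sherali–Adams gap, Thm 7.4, p. 20–21).
[cite: KothariMekaRaghavendra2017, Cor. 1.5 (p. 4)] -/
def KothariMekaRaghavendra2017_cor15_maxCut : Prop :=
  ∀ ε : ℝ, 0 < ε → ∃ c₃ : ℝ, 0 < c₃ ∧ ∃ n₀ : ℕ, ∀ n : ℕ, n₀ ≤ n →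
    ∀ R : ℕ, (R : ℝ) < (2 : ℝ) ^ ((n : ℝ) ^ c₃) →
      ∀ L : LPRelaxation 2 n maxCutPreds R, ¬ L.GapLT (2 - ε)

/-! ### LP relaxations versus nonnegative factorisations (appended; proofs only) -/

open Literature.Analysis.Convex (LPDuality.affine_farkas)

namespace LPRelaxation

variable {k n R : ℕ} {P : Set ((Fin k → Bool) → Bool)}

/-- The points `v_x` lie in the polytope. [cite: KothariMekaRaghavendra2017, Def. 1.1 (p. 3)] -/
theorem v_mem_polytope (L : LPRelaxation k n P R) (x : Fin n → Bool) : L.v x ∈ L.polytope :=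
  fun i => L.mem x i

/-- The relaxation value dominates the true value: `ℑ(x) ≤ opt_𝒫(ℑ)`, i.e. `opt_𝒫(ℑ) ≤ c` forces
`ℑ ≤ c` pointwise ("Clearly, `opt(ℑ) ≤ opt_𝒫(ℑ)`"). [cite: KothariMekaRaghavendra2017, §1.1 (p. 3)] -/
theorem ValueLE.val_le {L : LPRelaxation k n P R} {I : CSPInstance k n P} {c : ℝ}
    (h : L.ValueLE I c) (x : Fin n → Bool) : I.val x ≤ c := by
  rw [L.exact I x]
  exact h (L.v x) (L.v_mem_polytope x)

/-- **LP duality for an achieving relaxation** (Schrijver Cor. 7.1h applied to Def. 1.1): if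
`opt_𝒫(ℑ) ≤ c` then there are multipliers `λ ≥ 0` with `λᵀA = w_ℑ` and `λᵀ b ≤ c`.
[cite: KothariMekaRaghavendra2017, §1.2 (p. 4: "Yannakakis showed that the extended formulation complexity … is precisely the non-negative rank of the associated slack matrix. In [BFPS15], this connection was subsequently extended to approximation by linear programs")] -/
theorem ValueLE.exists_multipliers {L : LPRelaxation k n P R} {I : CSPInstance k n P} {c : ℝ}
    (h : L.ValueLE I c) :
    ∃ lam : Fin R → ℝ, 0 ≤ lam ∧ lam ᵥ* L.A = L.w I ∧ lam ⬝ᵥ L.b ≤ c := by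
  have hP : ∃ y : Fin L.D → ℝ, L.A *ᵥ y ≤ L.b := ⟨L.v fun _ => false, fun i => L.mem _ i⟩
  exact LPDuality.affine_farkas L.A L.b (L.w I) hP fun y hy => h y fun i => hy i

/-- **An LP relaxation of size `R` achieving a `(c,s)`-approximation yields a nonnegative
factorisation of size `R + 1` of the matrix `M^{n,Π}_{c,s}(ℑ,x) = c − ℑ(x)`** (the direction
"LP ⇒ nonnegative rank" of the [CLRS13]/Yannakakis characterisation, KMR Fact 7.2; the extra
column carries the constants `c − λ_ℑᵀ b ≥ 0`): `c − ℑ(x) = (c − λ_ℑᵀb)·1 + Σ_i (λ_ℑ)_i (b − A v_x)_i`.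
[cite: KothariMekaRaghavendra2017, Fact 7.2 (p. 20)] -/
theorem Achieves.hasNonnegFactorization {L : LPRelaxation k n P R} {c s : ℝ} (h : L.Achieves c s) :
    HasNonnegFactorization (cspMatrix k n P c s) (R + 1) := by
  choose lam hlam0 hlamA hlamb using
    fun I : SoundInstances k n P s => (h I.1 I.2).exists_multipliers
  -- index `0` = the constant column, `i.succ` = the `i`-th inequality
  refine ⟨fun I => Fin.cases (c - lam I ⬝ᵥ L.b) fun i => lam I i,
    fun j x => Fin.cases (motive := fun _ => ℝ) 1 (fun i => L.b i - (L.A *ᵥ L.v x) i) j,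
    fun I j => ?_, fun j x => ?_, fun I x => ?_⟩
  · refine Fin.cases ?_ (fun i => ?_) j
    · simpa using hlamb I
    · simpa using hlam0 I i
  · refine Fin.cases ?_ (fun i => ?_) j
    · simp
    · simpa using L.mem x i
  · rw [Fin.sum_univ_succ]
    simp only [Fin.cases_zero, Fin.cases_succ, mul_one]
    have hval : I.1.val x = lam I ⬝ᵥ (L.A *ᵥ L.v x) := by
      rw [L.exact I.1 x, ← hlamA I, dotProduct_mulVec]
    simp only [cspMatrix, hval, dotProduct, mul_sub, Finset.sum_sub_distrib]
    ring

end LPRelaxation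

/-! ### KMR Lemma 7.3: the pattern matrix `M_f^b` is a submatrix of `𝓜_{q·n,s}` (PROVED) -/

/-- Variables of the planted instances: `[n] × {0,1}^b ≃ [n · 2^b]` ("index the variables of `ℑ_y`
by `[n] × [q]`", `q = 2^b`). [cite: KothariMekaRaghavendra2017, Lemma 7.3 proof (p. 20)] -/
def blockVarEquiv (n b : ℕ) : Fin n × (Fin b → Bool) ≃ Fin (n * 2 ^ b) :=
  (Equiv.prodCongr (Equiv.refl (Fin n))
      (((Equiv.refl (Fin b)).arrowCongr finTwoEquiv.symm).trans finFunctionFinEquiv)).trans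
    finProdFinEquiv

/-- The planting embedding of `y ∈ [q]ⁿ`: variable `i` of `ℑ*` goes to variable `z_{i, y_i}`.
[cite: KothariMekaRaghavendra2017, Lemma 7.3 proof (p. 20: "planting the instance ℑ* on the subset of variables {z_{1,y_1},…,z_{n,y_n}}")] -/
def plantAlong {n : ℕ} (b : ℕ) (y : Fin n → Fin b → Bool) : Fin n ↪ Fin (n * 2 ^ b) :=
  ⟨fun i => blockVarEquiv n b (i, y i), fun i j h => by
    simpa using congrArg (fun v => ((blockVarEquiv n b).symm v).1) h⟩

/-- The assignment `x̃ ∈ {0,1}^{q·n}` encoding `x ∈ [q]ⁿ`: `x̃_{i,β} = g(x_i, β)` (the truth table of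
`g(x_i, ·)`). [cite: KothariMekaRaghavendra2017, Lemma 7.3 proof (p. 20: "x̃_i := g ∘ x_i")] -/
def gadgetAssignment {n : ℕ} (b : ℕ) (x : Fin n → Fin b → Bool) : Fin (n * 2 ^ b) → Bool :=
  fun v => ipGadget b (x ((blockVarEquiv n b).symm v).1) ((blockVarEquiv n b).symm v).2

/-- `ℑ_y(x̃) = ℑ*(g(x_1,y_1),…,g(x_n,y_n))`. [cite: KothariMekaRaghavendra2017, Lemma 7.3 proof (p. 20)] -/
theorem plant_plantAlong_val {k n b : ℕ} {P : Set ((Fin k → Bool) → Bool)} (I : CSPInstance k n P)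
    (x y : Fin n → Fin b → Bool) :
    (I.plant (plantAlong b y)).val (gadgetAssignment b x) = I.val fun i => ipGadget b (x i) (y i) := by
  rw [CSPInstance.plant_val]
  congr 1
  funext i
  simp [gadgetAssignment, plantAlong]

/-- **Kothari–Meka–Raghavendra 2017, Lemma 7.3 (PROVED): `M_f^g` is a submatrix of `𝓜_{q·n,s}`.**
For an instance `ℑ*` of CSP(`𝒫`) on `n` variables with `opt(ℑ*) ≤ s` and `f = c − ℑ*`, the pattern
matrix `M_f^b(x,y) = f(g(x_1,y_1),…,g(x_n,y_n))` is (the transpose of) the submatrix of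
`𝓜_{n·2^b,s}(ℑ,z) = c − ℑ(z)` on the planted instances `ℑ_y` and the gadget assignments `x̃`; hence
a nonnegative factorisation of `𝓜_{n·2^b,s}` of size `r` yields one of `M_f^b`
("therefore `nnr(𝓜_{q·n,s}) ≥ nnr(M_f)`"). [cite: KothariMekaRaghavendra2017, Lemma 7.3 (p. 20)] -/
theorem HasNonnegFactorization.ipPatternMatrix_of_cspMatrix {k n b r : ℕ}
    {P : Set ((Fin k → Bool) → Bool)} {c s : ℝ} (I : CSPInstance k n P) (hI : I.OptLE s)
    (h : HasNonnegFactorization (cspMatrix k (n * 2 ^ b) P c s) r) :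
    HasNonnegFactorization (ipPatternMatrix b fun z => c - I.val z) r := by
  obtain ⟨U, V, hU, hV, hM⟩ := h
  refine ⟨fun x l => V l (gadgetAssignment b x),
    fun l y => U ⟨I.plant (plantAlong b y), hI.plant _⟩ l,
    fun x l => hV _ _, fun l y => hU _ _, fun x y => ?_⟩
  have := hM ⟨I.plant (plantAlong b y), hI.plant _⟩ (gadgetAssignment b x)
  simp only [cspMatrix, plant_plantAlong_val] at this
  simp only [ipPatternMatrix]
  rw [this]
  exact Finset.sum_congr rfl fun l _ => mul_comm _ _

/-- **Kothari–Meka–Raghavendra 2017, Lemma 7.1 (PROVED, explicit form): LP lower bounds from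
pattern matrices.** Let `0 < s < c ≤ 1` (not needed), `ℑ*` an instance of CSP(`𝒫`) on `n` variables
with `opt(ℑ*) ≤ s`, `f = c − ℑ*`.  Any LP relaxation of CSP(`𝒫`) on `q·n = n·2^b` variables of size
`R` achieving a `(c,s)`-approximation yields a nonnegative factorisation of `M_f^b` of size `R + 1`
— i.e. "has size at least `R ≥ Ω(nnr(M_f^g))`" with the explicit constant `R ≥ nnr(M_f^b) − 1`
(Lemma 7.3 + the LP ⇒ nonnegative-rank direction of Fact 7.2, both proved above).
[cite: KothariMekaRaghavendra2017, Lemma 7.1 (p. 20)] -/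
theorem LPRelaxation.Achieves.hasNonnegFactorization_ipPatternMatrix {k n b R : ℕ}
    {P : Set ((Fin k → Bool) → Bool)} {c s : ℝ} {L : LPRelaxation k (n * 2 ^ b) P R}
    (hL : L.Achieves c s) (I : CSPInstance k n P) (hI : I.OptLE s) :
    HasNonnegFactorization (ipPatternMatrix b fun z => c - I.val z) (R + 1) :=
  hL.hasNonnegFactorization.ipPatternMatrix_of_cspMatrix I hI

/-! ### Sherali–Adams value versus conical juntas: KMR Fact 3.4 = [CLRS13] eq. (1.2) (third append; PROVED)

The LP duality behind the Sherali–Adams relaxation: for every `f : {0,1}ⁿ → ℝ` and `c`,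
`(∀ degree-d pseudoexpectations Ẽ, Ẽ[f] ≤ c) ↔ c − f is a conical d-junta`
(`SAPseudoexpectation.forall_le_iff_isConicalJunta`), whence Fact 3.4
(`KothariMekaRaghavendra2017_fact34`: `SA_d(ℑ) ≤ c ↔ deg_+(c − ℑ) ≤ d`) and the step of the proof
of Thm 1.2 that uses it (`exists_nonnegDegree_gt_of_not_saAchieves`).  The "⇒" direction is the
affine form of Farkas' lemma (`Literature.Analysis.Convex.LPDuality.affine_farkas`) applied to the
LP whose feasible points are the pseudoexpectations; "⇐" is [CLRS13] Lemma 2.4(i). -/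

variable {n : ℕ}

/-! ### Juntas and conical juntas: elementary API -/

/-- A `d`-junta is a `d'`-junta for `d ≤ d'`. [cite: KothariMekaRaghavendra2017, Def. 1.8 (p. 4)] -/
theorem IsJunta.mono {d d' : ℕ} {h : (Fin n → Bool) → ℝ} (hh : IsJunta d h) (hd : d ≤ d') :
    IsJunta d' h := by
  obtain ⟨S, hS, hdep⟩ := hh
  exact ⟨S, hS.trans hd, hdep⟩

/-- Constants are `d`-juntas (`S = ∅`). [cite: KothariMekaRaghavendra2017, Def. 1.8 (p. 4)] -/
theorem isJunta_const (d : ℕ) (a : ℝ) : IsJunta d (fun _ : Fin n → Bool => a) :=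
  ⟨∅, by simp, fun _ _ _ => rfl⟩

/-- Every function on `{0,1}ⁿ` is an `n`-junta. [cite: KothariMekaRaghavendra2017, Def. 1.8 (p. 4)] -/
theorem isJunta_self (h : (Fin n → Bool) → ℝ) : IsJunta n h :=
  ⟨univ, by simp, fun x y hxy => congrArg h (funext fun i => hxy i (mem_univ i))⟩

/-- A conical `d`-junta is a conical `d'`-junta for `d ≤ d'` (so "`deg_+(f) ≤ d`" is "`f` is a
conical `d`-junta"). [cite: KothariMekaRaghavendra2017, Def. 1.8/1.9 (p. 4)] -/
theorem IsConicalJunta.mono {d d' : ℕ} {f : (Fin n → Bool) → ℝ} (hf : IsConicalJunta d f)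
    (hd : d ≤ d') : IsConicalJunta d' f := by
  obtain ⟨t, lam, h, hlam, hj, hpos, hsum⟩ := hf
  exact ⟨t, lam, h, hlam, fun i => (hj i).mono hd, hpos, hsum⟩

/-- Conical juntas are pointwise nonnegative. [cite: KothariMekaRaghavendra2017, Def. 1.8 (p. 4)] -/
theorem IsConicalJunta.nonneg {d : ℕ} {f : (Fin n → Bool) → ℝ} (hf : IsConicalJunta d f)
    (x : Fin n → Bool) : 0 ≤ f x := by
  obtain ⟨t, lam, h, hlam, -, hpos, hsum⟩ := hf
  rw [hsum x]
  exact sum_nonneg fun i _ => mul_nonneg (hlam i) (hpos i x)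

/-- A conical combination over any finite index type is a conical `d`-junta (reindexing along
`Fintype.equivFin`). [cite: KothariMekaRaghavendra2017, Def. 1.8 (p. 4)] -/
theorem isConicalJunta_of_fintype {ι : Type*} [Fintype ι] {d : ℕ} {f : (Fin n → Bool) → ℝ}
    (lam : ι → ℝ) (h : ι → (Fin n → Bool) → ℝ) (hlam : ∀ i, 0 ≤ lam i)
    (hj : ∀ i, IsJunta d (h i)) (hpos : ∀ i x, 0 ≤ h i x) (hsum : ∀ x, f x = ∑ i, lam i * h i x) :
    IsConicalJunta d f := by
  classical
  refine ⟨Fintype.card ι, fun j => lam ((Fintype.equivFin ι).symm j),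
    fun j => h ((Fintype.equivFin ι).symm j), fun j => hlam _, fun j => hj _, fun j x => hpos _ x,
    fun x => ?_⟩
  rw [hsum x]
  exact ((Fintype.equivFin ι).symm.sum_comp (fun i => lam i * h i x)).symm

/-- A nonnegative function on `{0,1}ⁿ` is a conical `n`-junta (it is itself a nonnegative
`n`-junta); so `deg_+` is defined for every `f ≥ 0`. [cite: KothariMekaRaghavendra2017, Def. 1.9 (p. 4)] -/
theorem isConicalJunta_of_nonneg {f : (Fin n → Bool) → ℝ} (hf : ∀ x, 0 ≤ f x) :
    IsConicalJunta n f :=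
  isConicalJunta_of_fintype (ι := Unit) (fun _ => 1) (fun _ => f) (fun _ => zero_le_one)
    (fun _ => isJunta_self f) (fun _ => hf) fun x => by simp

/-- Positive scaling preserves conical `d`-juntas. [cite: KothariMekaRaghavendra2017, Def. 1.8 (p. 4)] -/
theorem IsConicalJunta.smul {d : ℕ} {f : (Fin n → Bool) → ℝ} (hf : IsConicalJunta d f) {a : ℝ}
    (ha : 0 ≤ a) : IsConicalJunta d (fun x => a * f x) := by
  obtain ⟨t, lam, h, hlam, hj, hpos, hsum⟩ := hf
  refine ⟨t, fun i => a * lam i, h, fun i => mul_nonneg ha (hlam i), hj, hpos, fun x => ?_⟩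
  show a * f x = _
  rw [hsum x, mul_sum]
  exact sum_congr rfl fun i _ => by ring

/-- Adding a nonnegative constant preserves conical `d`-juntas. [cite: KothariMekaRaghavendra2017, Def. 1.8 (p. 4)] -/
theorem IsConicalJunta.add_const {d : ℕ} {f : (Fin n → Bool) → ℝ} (hf : IsConicalJunta d f)
    {a : ℝ} (ha : 0 ≤ a) : IsConicalJunta d (fun x => f x + a) := by
  obtain ⟨t, lam, h, hlam, hj, hpos, hsum⟩ := hf
  refine isConicalJunta_of_fintype (ι := Option (Fin t)) (fun o => o.elim a lam)
    (fun o => o.elim (fun _ => 1) h) (fun o => ?_) (fun o => ?_) (fun o x => ?_) (fun x => ?_)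
  · cases o <;> simp [ha, hlam]
  · cases o
    · exact isJunta_const d 1
    · exact hj _
  · cases o <;> simp [hpos]
  · rw [hsum x, Fintype.sum_option]
    simp [add_comm]

/-- For `f ≥ 0`: `f` is a conical `d`-junta iff `deg_+(f) ≤ d`. [cite: KothariMekaRaghavendra2017, Def. 1.9 (p. 4)] -/
theorem isConicalJunta_iff_nonnegDegree_le {f : (Fin n → Bool) → ℝ} (hf : ∀ x, 0 ≤ f x) {d : ℕ} :
    IsConicalJunta d f ↔ nonnegDegree f ≤ d := by
  refine ⟨fun h => Nat.sInf_le h, fun h => ?_⟩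
  have hne : {d | IsConicalJunta d f}.Nonempty := ⟨n, isConicalJunta_of_nonneg hf⟩
  exact (Nat.sInf_mem hne).mono h

/-- `deg_+` is attained for `f ≥ 0`. [cite: KothariMekaRaghavendra2017, Def. 1.9 (p. 4)] -/
theorem isConicalJunta_nonnegDegree {f : (Fin n → Bool) → ℝ} (hf : ∀ x, 0 ≤ f x) :
    IsConicalJunta (nonnegDegree f) f :=
  (isConicalJunta_iff_nonnegDegree_le hf).2 le_rfl

/-- `deg_+(f) ≤ n` for `f ≥ 0` on `{0,1}ⁿ`. [cite: KothariMekaRaghavendra2017, Def. 1.9 (p. 4)] -/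
theorem nonnegDegree_le (f : (Fin n → Bool) → ℝ) : nonnegDegree f ≤ n := by
  by_cases hf : ∀ x, 0 ≤ f x
  · exact (isConicalJunta_iff_nonnegDegree_le hf).1 (isConicalJunta_of_nonneg hf)
  · have : {d | IsConicalJunta d f} = ∅ :=
      Set.eq_empty_iff_forall_notMem.2 fun d hd => hf hd.nonneg
    simp [nonnegDegree, this]

/-! ### Sherali–Adams pseudoexpectations versus conical juntas -/

namespace SAPseudoexpectation

variable {d : ℕ}

/-- `Ẽ[c] = c`. [cite: KothariMekaRaghavendra2017, Def. 3.3 (p. 9)] -/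
theorem map_const (pE : SAPseudoexpectation n d) (c : ℝ) : pE.E (fun _ => c) = c := by
  have : (fun _ : Fin n → Bool => c) = c • (fun _ : Fin n → Bool => (1 : ℝ)) := by
    funext x; simp
  rw [this, map_smul, pE.map_one, smul_eq_mul, mul_one]

/-- **Pseudoexpectations are nonnegative on conical juntas** ([CLRS13] Lemma 2.4(i) and the
paragraph after it): `Ẽ[Σ λ_i h_i] = Σ λ_i Ẽ[h_i] ≥ 0`.
[cite: ChanEtAl2016, Lemma 2.4(i) (arXiv v3 p. 12)] -/
theorem nonneg_of_isConicalJunta (pE : SAPseudoexpectation n d) {f : (Fin n → Bool) → ℝ}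
    (hf : IsConicalJunta d f) : 0 ≤ pE.E f := by
  obtain ⟨t, lam, h, hlam, hj, hpos, hsum⟩ := hf
  have : f = ∑ i, lam i • h i := by
    funext x
    simp only [hsum x, Finset.sum_apply, Pi.smul_apply, smul_eq_mul]
  rw [this, map_sum]
  exact sum_nonneg fun i _ => by
    rw [map_smul, smul_eq_mul]
    exact mul_nonneg (hlam i) (pE.nonneg _ (hj i) (hpos i))

/-- The easy direction of the duality: a conical-`d`-junta certificate `c − f = Σ λ_i h_i` bounds
every degree-`d` pseudoexpectation, `Ẽ[f] = c − Ẽ[c − f] ≤ c`.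
[cite: ChanEtAl2016, §2.1 (arXiv v3 pp. 12–13)] -/
theorem le_of_isConicalJunta (pE : SAPseudoexpectation n d) {f : (Fin n → Bool) → ℝ} {c : ℝ}
    (h : IsConicalJunta d (fun x => c - f x)) : pE.E f ≤ c := by
  have h0 := pE.nonneg_of_isConicalJunta h
  have hsplit : (fun x => c - f x) = (fun _ : Fin n → Bool => c) - f := by
    funext x; simp
  rw [hsplit, map_sub, pE.map_const] at h0
  linarith

end SAPseudoexpectation

/-! #### The generators of the cone of conical `d`-juntas and the LP behind `SA_d` -/

namespace SADuality

/-- Index set of the generators of the cone of conical `d`-juntas: a set `S` of at most `d`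
coordinates and a pattern `β` (only `β|_S` matters). [cite: ChanEtAl2016, eq. (1.2) (arXiv v3 p. 6)] -/
abbrev Gen (n d : ℕ) : Type := {S : Finset (Fin n) // S.card ≤ d} × (Fin n → Bool)

/-- The generator `𝟙[x|_S = β|_S]`, a nonnegative `d`-junta. [cite: ChanEtAl2016, eq. (1.2) (arXiv v3 p. 6)] -/
def gen {d : ℕ} (g : Gen n d) (x : Fin n → Bool) : ℝ := if ∀ i ∈ g.1.1, x i = g.2 i then 1 else 0

/-- Generators are nonnegative. [cite: ChanEtAl2016, eq. (1.2) (arXiv v3 p. 6)] -/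
theorem gen_nonneg {d : ℕ} (g : Gen n d) (x : Fin n → Bool) : 0 ≤ gen g x := by
  unfold gen; split_ifs <;> norm_num

/-- Generators are `d`-juntas. [cite: ChanEtAl2016, eq. (1.2) (arXiv v3 p. 6)] -/
theorem isJunta_gen {d : ℕ} (g : Gen n d) : IsJunta d (gen g) := by
  refine ⟨g.1.1, g.1.2, fun x y hxy => ?_⟩
  have : (∀ i ∈ g.1.1, x i = g.2 i) ↔ ∀ i ∈ g.1.1, y i = g.2 i :=
    forall₂_congr fun i hi => by rw [hxy i hi]
  simp only [gen, this]

/-- A nonnegative `d`-junta is a nonnegative combination of generators: with `S` its junta set,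
`p = Σ_β w_β 𝟙[x|_S = β|_S]`, `w_β = p(β)` for the patterns `β` vanishing off `S` (else `0`).
[cite: ChanEtAl2016, Lemma 2.4(i) (arXiv v3 p. 12)] -/
theorem junta_decomp {d : ℕ} {p : (Fin n → Bool) → ℝ} {S : Finset (Fin n)} (hS : S.card ≤ d)
    (hdep : ∀ x y : Fin n → Bool, (∀ i ∈ S, x i = y i) → p x = p y) (x : Fin n → Bool) :
    p x = ∑ β : Fin n → Bool,
      (if ∀ i ∉ S, β i = false then p β else 0) * gen (⟨S, hS⟩, β) x := by
  classical
  -- the unique contributing pattern: `x` on `S`, `false` off `S`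
  set xS : Fin n → Bool := fun i => if i ∈ S then x i else false with hxS
  have hpx : p xS = p x := hdep xS x fun i hi => by simp [hxS, hi]
  have hterm : ∀ β : Fin n → Bool,
      (if ∀ i ∉ S, β i = false then p β else 0) * gen (d := d) (⟨S, hS⟩, β) x =
        if β = xS then p x else 0 := by
    intro β
    by_cases hβ : β = xS
    · subst hβ
      have h1 : ∀ i ∉ S, xS i = false := fun i hi => by simp [hxS, hi]
      have h2 : ∀ i ∈ S, x i = xS i := fun i hi => by simp [hxS, hi]
      rw [if_pos rfl, if_pos h1]
      simp only [gen]
      rw [if_pos h2, hpx, mul_one]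
    · rw [if_neg hβ]
      by_cases hoff : ∀ i ∉ S, β i = false
      · have hon : ¬ ∀ i ∈ S, x i = β i := by
          intro hon
          apply hβ
          funext i
          by_cases hi : i ∈ S
          · simp [hxS, hi, hon i hi]
          · simp [hxS, hi, hoff i hi]
        simp [gen, hon]
      · rw [if_neg hoff, zero_mul]
  simp_rw [hterm]
  simp

variable (n d) in
/-- Constraint rows of the LP `max {⟨f, y⟩ : ⟨gen_g, y⟩ ≥ 0 ∀ g, ⟨1, y⟩ = 1}` whose feasible
points are exactly the degree-`d` pseudoexpectations (as vectors `y ∈ ℝ^{{0,1}ⁿ}`, the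
"`Ẽ ∈ L²({−1,1}ⁿ)`" of [CLRS13] §2.1). [cite: ChanEtAl2016, eq. (2.3) (arXiv v3 p. 12)] -/
def lpMatrix : Matrix (Gen n d ⊕ Bool) (Fin n → Bool) ℝ :=
  Sum.elim (fun g x => -gen g x) (fun b _ => if b then 1 else -1)

variable (n d) in
/-- Right-hand sides: `0` for the generator rows, `1`, `−1` for the two normalisation rows.
[cite: ChanEtAl2016, eq. (2.3) (arXiv v3 p. 12)] -/
def lpRHS : Gen n d ⊕ Bool → ℝ := Sum.elim (fun _ => 0) (fun b => if b then 1 else -1)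

/-- Generator rows of `A y`. [cite: ChanEtAl2016, eq. (2.3) (arXiv v3 p. 12)] -/
theorem mulVec_lpMatrix_inl {d : ℕ} (y : (Fin n → Bool) → ℝ) (g : Gen n d) :
    (lpMatrix n d *ᵥ y) (Sum.inl g) = -(gen g ⬝ᵥ y) := by
  simp [lpMatrix, Matrix.mulVec, dotProduct, Finset.sum_neg_distrib]

/-- Normalisation rows of `A y`. [cite: ChanEtAl2016, eq. (2.3) (arXiv v3 p. 12)] -/
theorem mulVec_lpMatrix_inr {d : ℕ} (y : (Fin n → Bool) → ℝ) (bb : Bool) :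
    (lpMatrix n d *ᵥ y) (Sum.inr bb) = if bb then ∑ x, y x else -∑ x, y x := by
  cases bb <;> simp [lpMatrix, Matrix.mulVec, dotProduct, Finset.sum_neg_distrib]

/-- A point mass is feasible (the LP (2.3) is feasible). [cite: ChanEtAl2016, eq. (2.3) (arXiv v3 p. 12)] -/
theorem feasible (d : ℕ) : ∃ y : (Fin n → Bool) → ℝ, lpMatrix n d *ᵥ y ≤ lpRHS n d := by
  classical
  refine ⟨fun x => if x = fun _ => false then 1 else 0, fun i => ?_⟩
  rcases i with g | bb
  · rw [mulVec_lpMatrix_inl]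
    simp only [lpRHS, Sum.elim_inl, dotProduct, mul_ite, mul_one, mul_zero, Finset.sum_ite_eq',
      Finset.mem_univ, if_true, neg_nonpos]
    exact gen_nonneg g _
  · rw [mulVec_lpMatrix_inr]
    cases bb <;> simp [lpRHS]

/-- A feasible point of the LP is a degree-`d` pseudoexpectation `p ↦ ⟨y, p⟩` (nonnegativity on
ALL nonnegative `d`-juntas from nonnegativity on the generators, via `junta_decomp`).
[cite: ChanEtAl2016, Lemma 2.4(i) (arXiv v3 p. 12)] -/
def toPE {d : ℕ} (y : (Fin n → Bool) → ℝ) (hy : lpMatrix n d *ᵥ y ≤ lpRHS n d) : SAPseudoexpectation n d where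
  E :=
    { toFun := fun p => y ⬝ᵥ p
      map_add' := fun p q => dotProduct_add y p q
      map_smul' := fun a p => by simp [dotProduct_smul] }
  nonneg := by
    intro p hp hp0
    obtain ⟨S, hS, hdep⟩ := hp
    show 0 ≤ y ⬝ᵥ p
    have hdec : p = ∑ β : Fin n → Bool,
        (if ∀ i ∉ S, β i = false then p β else 0) • gen (⟨S, hS⟩, β) := by
      funext x
      rw [junta_decomp hS hdep x]
      simp only [Finset.sum_apply, Pi.smul_apply, smul_eq_mul]
    rw [hdec, dotProduct_sum]
    refine sum_nonneg fun β _ => ?_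
    rw [dotProduct_smul, smul_eq_mul]
    refine mul_nonneg (by split_ifs <;> simp [hp0]) ?_
    have := hy (Sum.inl (⟨S, hS⟩, β))
    rw [mulVec_lpMatrix_inl] at this
    simp only [lpRHS, Sum.elim_inl, neg_nonpos] at this
    rwa [dotProduct_comm]
  map_one := by
    show y ⬝ᵥ (fun _ => 1) = 1
    have h1 := hy (Sum.inr true)
    have h2 := hy (Sum.inr false)
    rw [mulVec_lpMatrix_inr] at h1 h2
    simp only [lpRHS, Sum.elim_inr, if_true] at h1
    simp only [lpRHS, Sum.elim_inr] at h2
    have : y ⬝ᵥ (fun _ => (1 : ℝ)) = ∑ x, y x := by simp [dotProduct]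
    rw [this]
    simp at h2
    linarith

/-- Unfolding `toPE`. [cite: ChanEtAl2016, eq. (2.3) (arXiv v3 p. 12)] -/
@[simp] theorem toPE_E {d : ℕ} (y : (Fin n → Bool) → ℝ) (hy : lpMatrix n d *ᵥ y ≤ lpRHS n d)
    (p : (Fin n → Bool) → ℝ) : (toPE y hy).E p = y ⬝ᵥ p := rfl

end SADuality

/-- **Sherali–Adams value versus conical juntas: the LP duality (PROVED).** For every
`f : {0,1}ⁿ → ℝ`, `c ∈ ℝ` and `d`: every degree-`d` Sherali–Adams pseudoexpectation has `Ẽ[f] ≤ c`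
if and only if `c − f` is a conical `d`-junta (a nonnegative combination of nonnegative `d`-juntas).
"⇐" is [CLRS13] Lemma 2.4(i); "⇒" is LP duality: the pseudoexpectations are the feasible points of
the LP `⟨𝟙[x|_S = β], y⟩ ≥ 0 (|S| ≤ d), ⟨1, y⟩ = 1`, so by the affine form of Farkas' lemma
(`LPDuality.affine_farkas`, Schrijver Cor. 7.1h) the valid inequality `⟨f, y⟩ ≤ c` is a nonnegative
combination of the constraints, which exhibits `c − f` as `λ₀ · 1 + Σ_g λ_g 𝟙[x|_S = β]`.
[cite: ChanEtAl2016, eq. (1.2) (arXiv v3 p. 6) with §2.1 (pp. 12–13)]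
[cite: KothariMekaRaghavendra2017, Fact 3.4 (p. 9)] -/
theorem SAPseudoexpectation.forall_le_iff_isConicalJunta (d : ℕ) (f : (Fin n → Bool) → ℝ) (c : ℝ) :
    (∀ pE : SAPseudoexpectation n d, pE.E f ≤ c) ↔ IsConicalJunta d (fun x => c - f x) := by
  refine ⟨fun h => ?_, fun h pE => pE.le_of_isConicalJunta h⟩
  classical
  -- every feasible `y` is a pseudoexpectation, so `⟨f, y⟩ ≤ c` is valid over the LP
  have hvalid : ∀ y : (Fin n → Bool) → ℝ, SADuality.lpMatrix n d *ᵥ y ≤ SADuality.lpRHS n d → f ⬝ᵥ y ≤ c := by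
    intro y hy
    rw [dotProduct_comm]
    exact h (SADuality.toPE y hy)
  obtain ⟨lam, hlam, hlamA, hlamb⟩ :=
    LPDuality.affine_farkas (SADuality.lpMatrix n d) (SADuality.lpRHS n d) f (SADuality.feasible d) hvalid
  -- read off the certificate
  have hf : ∀ x, f x = -(∑ g : SADuality.Gen n d, lam (Sum.inl g) * SADuality.gen g x) +
      (lam (Sum.inr true) - lam (Sum.inr false)) := by
    intro x
    have := congrFun hlamA x
    simp only [Matrix.vecMul, dotProduct, Fintype.sum_sum_type, Fintype.sum_bool, SADuality.lpMatrix,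
      Sum.elim_inl, Sum.elim_inr, if_true, Bool.false_eq_true, if_false, mul_neg, mul_one,
      Finset.sum_neg_distrib] at this
    rw [← this]
    ring
  have hconst : lam (Sum.inr true) - lam (Sum.inr false) ≤ c := by
    have := hlamb
    simp only [dotProduct, Fintype.sum_sum_type, Fintype.sum_bool, SADuality.lpRHS, Sum.elim_inl,
      Sum.elim_inr, if_true, Bool.false_eq_true, if_false, mul_zero, Finset.sum_const_zero,
      zero_add, mul_one, mul_neg] at this
    linarith
  refine isConicalJunta_of_fintype (ι := Option (SADuality.Gen n d))
    (fun o => o.elim (c - (lam (Sum.inr true) - lam (Sum.inr false))) fun g => lam (Sum.inl g))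
    (fun o => o.elim (fun _ => 1) fun g => SADuality.gen g) (fun o => ?_) (fun o => ?_)
    (fun o x => ?_) (fun x => ?_)
  · cases o
    · simpa using hconst
    · simpa using hlam _
  · cases o
    · exact isJunta_const d 1
    · exact SADuality.isJunta_gen _
  · cases o
    · simp
    · simpa using SADuality.gen_nonneg _ x
  · rw [Fintype.sum_option, hf x]
    simp only [Option.elim_none, Option.elim_some, mul_one]
    ring

/-- **Kothari–Meka–Raghavendra 2017, Fact 3.4 = [CLRS13] (Sherali–Adams value and nonnegative
degree), PROVED.** "Let `P : {−1,1}^k → {0,1}` be a predicate and `ℑ` an instance of CSP(`P`). Then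
`SA_d(ℑ) ≤ c` if and only if `deg_+(c − ℑ) ≤ d`", i.e. (Def. 1.8/1.9) iff `c − ℑ` is a conical
`d`-junta; here for instances of any Boolean Max-CSP (the predicate plays no role) and every `d`
(`SA_d(ℑ) ≤ c` = every degree-`d` pseudoexpectation has `Ẽ[ℑ] ≤ c`, the reading of `SAAchieves`).
[cite: KothariMekaRaghavendra2017, Fact 3.4 (p. 9)]
[cite: ChanEtAl2016, eq. (1.2) (arXiv v3 p. 6)] -/
theorem KothariMekaRaghavendra2017_fact34 {k d : ℕ} {P : Set ((Fin k → Bool) → Bool)}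
    (I : CSPInstance k n P) (c : ℝ) :
    (∀ pE : SAPseudoexpectation n d, pE.E I.val ≤ c) ↔ IsConicalJunta d (fun x => c - I.val x) :=
  SAPseudoexpectation.forall_le_iff_isConicalJunta d I.val c

/-- Fact 3.4 in the `deg_+` currency, for `c ≥ opt(ℑ)` (so that `c − ℑ ≥ 0` and `deg_+(c − ℑ)` is
defined): `SA_d(ℑ) ≤ c ↔ deg_+(c − ℑ) ≤ d`. [cite: KothariMekaRaghavendra2017, Fact 3.4 (p. 9)] -/
theorem KothariMekaRaghavendra2017_fact34_nonnegDegree {k d : ℕ} {P : Set ((Fin k → Bool) → Bool)}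
    (I : CSPInstance k n P) {c : ℝ} (hc : I.OptLE c) :
    (∀ pE : SAPseudoexpectation n d, pE.E I.val ≤ c) ↔ nonnegDegree (fun x => c - I.val x) ≤ d := by
  rw [KothariMekaRaghavendra2017_fact34,
    isConicalJunta_iff_nonnegDegree_le fun x => sub_nonneg.2 (hc x)]

/-- **The use of Fact 3.4 in the proof of Thm 1.2 (p. 20):** if the degree-`d` Sherali–Adams
relaxation of Max-`𝒫` cannot achieve a `(c,s)`-approximation on `n`-variable instances, there is an
instance `ℑ` with `opt(ℑ) ≤ s` such that `c − ℑ` is NOT a conical `d`-junta ("the dual to the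
`f(n)`-round Sherali–Adams linear program corresponds to expressing `c − ℑ_n` as a sum of
non-negative `f(n)`-juntas"); when `s ≤ c`, `deg_+(c − ℑ) > d`.
[cite: KothariMekaRaghavendra2017, proof of Thm 1.2 (p. 20)] -/
theorem exists_not_isConicalJunta_of_not_saAchieves {k d : ℕ} {P : Set ((Fin k → Bool) → Bool)}
    {c s : ℝ} (h : ¬ SAAchieves (n := n) P d c s) :
    ∃ I : CSPInstance k n P, I.OptLE s ∧ ¬ IsConicalJunta d (fun x => c - I.val x) := by
  simp only [SAAchieves, not_forall, not_le, exists_prop] at h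
  obtain ⟨I, hI, pE, hpE⟩ := h
  exact ⟨I, hI, fun hcj => absurd (pE.le_of_isConicalJunta hcj) (not_le.2 hpE)⟩

/-- The `deg_+` reading: `SA_d` fails `(c,s)` at `n` and `s ≤ c` ⇒ some `ℑ` with `opt(ℑ) ≤ s` has
`deg_+(c − ℑ) > d`. [cite: KothariMekaRaghavendra2017, proof of Thm 1.2 (p. 20: "deg_+(I_n + 1/n) ≥ f(n)")] -/
theorem exists_nonnegDegree_gt_of_not_saAchieves {k d : ℕ} {P : Set ((Fin k → Bool) → Bool)}
    {c s : ℝ} (hsc : s ≤ c) (h : ¬ SAAchieves (n := n) P d c s) :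
    ∃ I : CSPInstance k n P, I.OptLE s ∧ d < nonnegDegree (fun x => c - I.val x) := by
  obtain ⟨I, hI, hcj⟩ := exists_not_isConicalJunta_of_not_saAchieves h
  refine ⟨I, hI, not_le.1 fun hle => hcj ?_⟩
  exact (isConicalJunta_iff_nonnegDegree_le fun x => sub_nonneg.2 ((hI x).trans hsc)).2 hle

/-! ### Assembling Theorem 1.2 from Theorem 1.10 (the printed proof of §7, p. 20) -/

/-! #### Degree bookkeeping: `ℑ` has degree `≤ k` -/

/-- Degree bounds are monotone. [cite: LeeRaghavendraSteurer2015, §1 ("deg(g)")] -/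
theorem HasDegreeLE.mono {m k k' : ℕ} {f : (Fin m → Bool) → ℝ} (hf : HasDegreeLE k f)
    (hk : k ≤ k') : HasDegreeLE k' f := by
  obtain ⟨P, hP, hPf⟩ := hf
  exact ⟨P, hP.trans hk, hPf⟩

/-- Sums of degree-`≤ k` functions have degree `≤ k`. [cite: LeeRaghavendraSteurer2015, §1 ("deg(g)")] -/
theorem HasDegreeLE.add {m k : ℕ} {f g : (Fin m → Bool) → ℝ} (hf : HasDegreeLE k f)
    (hg : HasDegreeLE k g) : HasDegreeLE k (fun x => f x + g x) := by
  obtain ⟨P, hP, hPf⟩ := hf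
  obtain ⟨Q, hQ, hQg⟩ := hg
  exact ⟨P + Q, (MvPolynomial.totalDegree_add P Q).trans (max_le hP hQ), fun x => by
    simp [hPf x, hQg x]⟩

/-- Differences of degree-`≤ k` functions have degree `≤ k`. [cite: LeeRaghavendraSteurer2015, §1 ("deg(g)")] -/
theorem HasDegreeLE.sub {m k : ℕ} {f g : (Fin m → Bool) → ℝ} (hf : HasDegreeLE k f)
    (hg : HasDegreeLE k g) : HasDegreeLE k (fun x => f x - g x) := by
  obtain ⟨P, hP, hPf⟩ := hf
  obtain ⟨Q, hQ, hQg⟩ := hg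
  exact ⟨P - Q, (MvPolynomial.totalDegree_sub P Q).trans (max_le hP hQ), fun x => by
    simp [hPf x, hQg x]⟩

/-- Scalar multiples of degree-`≤ k` functions have degree `≤ k`. [cite: LeeRaghavendraSteurer2015, §1 ("deg(g)")] -/
theorem HasDegreeLE.const_mul {m k : ℕ} {f : (Fin m → Bool) → ℝ} (a : ℝ) (hf : HasDegreeLE k f) :
    HasDegreeLE k (fun x => a * f x) := by
  obtain ⟨P, hP, hPf⟩ := hf
  refine ⟨MvPolynomial.C a * P, (MvPolynomial.totalDegree_mul _ _).trans ?_, fun x => by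
    simp [hPf x]⟩
  rw [MvPolynomial.totalDegree_C, zero_add]
  exact hP

/-- Finite sums of degree-`≤ k` functions have degree `≤ k`. [cite: LeeRaghavendraSteurer2015, §1 ("deg(g)")] -/
theorem HasDegreeLE.sum {m k : ℕ} {ι : Type*} (s : Finset ι) {f : ι → (Fin m → Bool) → ℝ}
    (hf : ∀ i ∈ s, HasDegreeLE k (f i)) : HasDegreeLE k (fun x => ∑ i ∈ s, f i x) := by
  classical
  induction s using Finset.induction_on with
  | empty => simpa using HasDegreeLE.const (m := m) k 0
  | insert a s ha ih =>
    have h := (hf a (Finset.mem_insert_self _ _)).add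
      (ih fun i hi => hf i (Finset.mem_insert_of_mem hi))
    simpa [Finset.sum_insert ha] using h

/-- `deg(f) ≤ k` whenever `f` has degree at most `k`. [cite: KothariMekaRaghavendra2017, Thm 1.10 (p. 5: "deg(f)")] -/
theorem cubeDegree_le_of_hasDegreeLE {m k : ℕ} {f : (Fin m → Bool) → ℝ} (hf : HasDegreeLE k f) :
    cubeDegree f ≤ k :=
  Nat.sInf_le hf

namespace CSPConstraint

variable {k n : ℕ} {P : Set ((Fin k → Bool) → Bool)}

/-- **A `k`-ary constraint is a polynomial of degree `≤ k`** (multilinear interpolation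
`P_0(x) = Σ_{α ∈ {0,1}^k} P(α) Π_j ℓ_{α_j}(x_{i_j})`, `ℓ_1(t) = t`, `ℓ_0(t) = 1 − t`): the satisfaction
indicator of `P(x_{i_1},…,x_{i_k})` has degree at most `k`.
[cite: KothariMekaRaghavendra2017, §3.3 (p. 9: "we can canonically encode it as a polynomial of degree k")] -/
theorem hasDegreeLE_sat (C : CSPConstraint k n P) :
    HasDegreeLE k (fun x => if C.sat x then (1 : ℝ) else 0) := by
  classical
  -- the literal polynomials `ℓ_b(X_i)`
  let lit : Fin n → Bool → MvPolynomial (Fin n) ℝ := fun i b =>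
    if b then MvPolynomial.X i else 1 - MvPolynomial.X i
  have lit_deg : ∀ i b, (lit i b).totalDegree ≤ 1 := by
    intro i b
    cases b
    · refine (MvPolynomial.totalDegree_sub _ _).trans (max_le ?_ ?_)
      · simp
      · exact le_of_eq (MvPolynomial.totalDegree_X _)
    · exact le_of_eq (MvPolynomial.totalDegree_X _)
  have lit_eval : ∀ (i : Fin n) (b : Bool) (x : Fin n → Bool),
      MvPolynomial.eval (cubePoint x) (lit i b) = if x i = b then 1 else 0 := by
    intro i b x
    cases b <;> cases hx : x i <;> simp [lit, cubePoint, hx]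
  refine ⟨∑ α : Fin k → Bool, if C.pred α then ∏ j, lit (C.idx j) (α j) else 0, ?_, fun x => ?_⟩
  · refine (MvPolynomial.totalDegree_finsetSum _ _).trans (Finset.sup_le fun α _ => ?_)
    split_ifs
    · refine (MvPolynomial.totalDegree_finsetProd _ _).trans ?_
      calc ∑ j, (lit (C.idx j) (α j)).totalDegree ≤ ∑ _j : Fin k, 1 :=
            Finset.sum_le_sum fun j _ => lit_deg _ _
        _ = k := by simp
    · simp
  · rw [map_sum]
    have hterm : ∀ α : Fin k → Bool,
        MvPolynomial.eval (cubePoint x) (if C.pred α then ∏ j, lit (C.idx j) (α j) else 0) =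
          if α = fun j => x (C.idx j) then (if C.pred α then 1 else 0) else 0 := by
      intro α
      by_cases hα : α = fun j => x (C.idx j)
      · subst hα
        simp only [if_true]
        split_ifs
        · rw [map_prod]
          simp [lit_eval]
        · simp
      · rw [if_neg hα]
        split_ifs
        · rw [map_prod]
          simp_rw [lit_eval]
          rw [Finset.prod_boole]
          rw [if_neg]
          intro hall
          exact hα (funext fun j => (hall j (Finset.mem_univ j)).symm)
        · simp
    simp_rw [hterm]
    rw [Finset.sum_ite_eq']
    simp [CSPConstraint.sat]

end CSPConstraint

/-- **The objective `ℑ` of a `k`-ary Max-CSP instance has degree `≤ k`** ("`P_ℑ : {−1,1}ⁿ → [0,1]`,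
a polynomial of degree `k`"). [cite: KothariMekaRaghavendra2017, §3.3 (p. 9)] -/
theorem CSPInstance.hasDegreeLE_val {k n : ℕ} {P : Set ((Fin k → Bool) → Bool)}
    (I : CSPInstance k n P) : HasDegreeLE k I.val := by
  have h := (HasDegreeLE.sum Finset.univ fun i _ => (I.cons i).hasDegreeLE_sat).const_mul
    ((I.M : ℝ)⁻¹)
  convert h using 1
  funext x
  simp [CSPInstance.val, div_eq_inv_mul]

/-! #### Cube expectations (linear algebra of `E_x`) -/

/-- `E[a] = a`. [cite: LeeRaghavendraSteurer2015, §2] -/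
theorem cubeExpect_const (m : ℕ) (a : ℝ) : cubeExpect (fun _ : Fin m → Bool => a) = a := by
  have h := cubeExpect_one m
  simp only [cubeExpect, Finset.sum_const, nsmul_eq_mul, mul_one] at h ⊢
  rw [mul_comm, mul_div_assoc, h, mul_one]

/-- `E[a·g] = a·E[g]`. [cite: LeeRaghavendraSteurer2015, §2] -/
theorem cubeExpect_const_mul {m : ℕ} (a : ℝ) (g : (Fin m → Bool) → ℝ) :
    cubeExpect (fun x => a * g x) = a * cubeExpect g := by
  simp only [cubeExpect, ← Finset.mul_sum, mul_div_assoc]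

/-- `E[a − g] = a − E[g]`. [cite: LeeRaghavendraSteurer2015, §2] -/
theorem cubeExpect_const_sub {m : ℕ} (a : ℝ) (g : (Fin m → Bool) → ℝ) :
    cubeExpect (fun x => a - g x) = a - cubeExpect g := by
  have h := cubeExpect_const m a
  simp only [cubeExpect] at h ⊢
  rw [Finset.sum_sub_distrib, sub_div, h]

/-- `g ≤ s` pointwise gives `E[g] ≤ s`. [cite: LeeRaghavendraSteurer2015, §2] -/
theorem cubeExpect_le_of_forall_le {m : ℕ} {g : (Fin m → Bool) → ℝ} {s : ℝ} (h : ∀ x, g x ≤ s) :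
    cubeExpect g ≤ s := by
  have h0 : 0 ≤ cubeExpect (fun x => s - g x) := cubeExpect_nonneg fun x => sub_nonneg.2 (h x)
  rw [cubeExpect_const_sub] at h0
  linarith

/-! #### Scalings -/

/-- Entrywise scaling by `a ≥ 0` preserves nonnegative factorisations of a given size.
[cite: KothariMekaRaghavendra2017, Def. 1.6 (p. 4)] -/
theorem HasNonnegFactorization.const_mul {ι κ : Type*} {M : ι → κ → ℝ} {r : ℕ}
    (h : HasNonnegFactorization M r) {a : ℝ} (ha : 0 ≤ a) :
    HasNonnegFactorization (fun i j => a * M i j) r := by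
  obtain ⟨U, V, hU, hV, hM⟩ := h
  refine ⟨fun i l => a * U i l, V, fun i l => mul_nonneg ha (hU i l), hV, fun i j => ?_⟩
  show a * M i j = _
  rw [hM i j, Finset.mul_sum]
  simp [mul_assoc]

/-- `M^b_{a f} = a · M^b_f`. [cite: KothariMekaRaghavendra2017, Def. 1.7 (p. 4)] -/
theorem ipPatternMatrix_const_mul {n : ℕ} (b : ℕ) (a : ℝ) (f : (Fin n → Bool) → ℝ) :
    ipPatternMatrix b (fun z => a * f z) = fun x y => a * ipPatternMatrix b f x y := rfl

/-- `deg_+(a f) = deg_+(f)` for `a > 0`. [cite: KothariMekaRaghavendra2017, Def. 1.9 (p. 4)] -/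
theorem nonnegDegree_const_mul {n : ℕ} {f : (Fin n → Bool) → ℝ} {a : ℝ} (ha : 0 < a) :
    nonnegDegree (fun x => a * f x) = nonnegDegree f := by
  unfold nonnegDegree
  congr 1
  ext d
  refine ⟨fun h => ?_, fun h => h.smul ha.le⟩
  have h' := h.smul (inv_nonneg.2 ha.le)
  simpa [inv_mul_cancel_left₀ ha.ne'] using h'

/-! #### Restricting an LP relaxation to fewer variables (padding) -/

namespace LPRelaxation

variable {k n' N R : ℕ} {P : Set ((Fin k → Bool) → Bool)}

/-- **Restriction of an LP relaxation to instances on fewer variables.** An LP relaxation for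
`n'`-variable instances yields one of the same size for `N`-variable instances along any embedding
`e : [N] ↪ [n']`: plant the instance along `e` (`w'_ℑ = w_{ℑ_e}`), extend assignments by `0` off the
image (`v'_z = v_{z^e}`); `ℑ(z) = ℑ_e(z^e) = ⟨w_{ℑ_e}, v_{z^e}⟩`, same polytope.  (Used to read "on
`n^H` variables" for the `N = n · 2^b ≤ n^H` variables the proof produces.)
[cite: KothariMekaRaghavendra2017, proof of Thm 1.2 (p. 20: "no linear program of size n^{h f(n)} can … approximate the CSP on instances with n^H variables")] -/
def restrict (L : LPRelaxation k n' P R) (e : Fin N ↪ Fin n') : LPRelaxation k N P R where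
  D := L.D
  v z := L.v (Function.extend e z fun _ => false)
  w I := L.w (I.plant e)
  exact I z := by
    have hz : (Function.extend e z fun _ => false) ∘ e = z :=
      funext fun i => e.injective.extend_apply _ _ i
    rw [← L.exact (I.plant e), CSPInstance.plant_val, hz]
  A := L.A
  b := L.b
  mem z i := L.mem _ i
  bounded := L.bounded

/-- Restriction preserves `(c,s)`-approximation (planting preserves `opt ≤ s`).
[cite: KothariMekaRaghavendra2017, proof of Thm 1.2 (p. 20)] -/
theorem Achieves.restrict {L : LPRelaxation k n' P R} {c s : ℝ} (h : L.Achieves c s)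
    (e : Fin N ↪ Fin n') : (L.restrict e).Achieves c s :=
  fun I hI y hy => h (I.plant e) (hI.plant e) y hy

end LPRelaxation

/-! #### The assembly -/

/-- **Kothari–Meka–Raghavendra 2017, Theorem 1.2 DERIVED from Theorem 1.10 — in the form the printed
proof (§7, p. 20) delivers (PROVED modulo the typed fact `KothariMekaRaghavendra2017_thm110`).**
There are `h > 0`, `H ∈ ℕ` with `h < H`, and `n₀` such that for every Boolean Max-CSP `𝒫` of arity
`k`, all `c ≤ 1` and `s`, every `f : ℕ → ℕ` and every `n ≥ n₀` with `1/n < c − s` and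
`f(n) ≥ 16k`: if the degree-`f(n)` Sherali–Adams relaxation cannot achieve a `(c,s)`-approximation
on `n`-variable instances, then no LP relaxation of size `R ≤ n^{h f(n)}` achieves a
`(c − 1/n, s)`-approximation on `n^H`-variable instances.  The proof is the printed one: Fact 3.4
(`exists_nonnegDegree_gt_of_not_saAchieves`: an instance `ℑ_n` with `opt ≤ s`,
`deg_+(c − ℑ_n) > f(n)`); `I_n = c − 1/n − ℑ_n ≥ 0`, normalised to mean `1` (`deg_+`, `deg` are
scale invariant, `deg(ℑ_n) ≤ k`); Thm 1.10 with `η = 1/(n E[I_n]) ≥ 1/n`, `b = ⌈C log₂ n⌉ + 1`, giving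
`nnr(M^b_{I_n}) ≥ 2^{c b (f(n) + 1 − 8k)} ≥ n^{cC(f(n)/2 + 1)} > n^{h f(n)} + 1`; Lemma 7.3/7.1
(`LPRelaxation.Achieves.hasNonnegFactorization_ipPatternMatrix`) on `n · 2^b ≤ n^H` variables
(`LPRelaxation.restrict`).  Relative to `KothariMekaRaghavendra2017_thm12` AS PRINTED the differences
are exactly the ones the printed proof carries: the conclusion is for `(c − 1/n, s)` (last line of the
proof, p. 20), `I_n ≥ 0` needs `s ≤ c − 1/n`, and the loss `−8 deg(f)` of Thm 1.10 is absorbed by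
`f(n) ≥ 16k` ("for some constants `h, H ∈ ℕ`"); `n ≥ n₀` makes `n^{cC} > 2`.
[cite: KothariMekaRaghavendra2017, Thm 1.2 and its proof (pp. 3, 20)] -/
theorem KothariMekaRaghavendra2017_thm12_of_thm110 (h110 : KothariMekaRaghavendra2017_thm110) :
    ∃ (h : ℝ) (H n₀ : ℕ), 0 < h ∧ h < H ∧
      ∀ (k : ℕ) (P : Set ((Fin k → Bool) → Bool)) (c s : ℝ), c ≤ 1 →
      ∀ (f : ℕ → ℕ) (n : ℕ), n₀ ≤ n → 1 / (n : ℝ) < c - s → 16 * k ≤ f n →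
        ¬ SAAchieves (n := n) P (f n) c s →
        ∀ R : ℕ, (R : ℝ) ≤ (n : ℝ) ^ (h * f n) →
          ∀ L : LPRelaxation k (n ^ H) P R, ¬ L.Achieves (c - 1 / n) s := by
  obtain ⟨c₀, C, hc₀, hC, h110⟩ := h110
  have hcC : 0 < c₀ * C := mul_pos hc₀ hC
  refine ⟨min (c₀ * C / 2) 1, ⌈C⌉₊ + 3, ⌈(2 : ℝ) ^ (1 / (c₀ * C))⌉₊ + 2,
    lt_min (by positivity) one_pos, ?_, ?_⟩
  · calc min (c₀ * C / 2) 1 ≤ 1 := min_le_right _ _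
      _ < ((⌈C⌉₊ + 3 : ℕ) : ℝ) := by push_cast; linarith [Nat.cast_nonneg (α := ℝ) ⌈C⌉₊]
  intro k P c s hc1 f n hn hgap hk hSA R hR L hL
  -- numerics about `n`
  have hn2 : 2 ≤ n := le_trans (by omega) hn
  have hn1' : 1 ≤ n := by omega
  have hn_pos : (0 : ℝ) < n := by exact_mod_cast (by omega : 0 < n)
  have hn1 : (1 : ℝ) ≤ n := by exact_mod_cast hn1'
  have hinv_nonneg : (0 : ℝ) ≤ 1 / n := by positivity
  have hsc : s ≤ c := by linarith
  -- Step 1 (Fact 3.4): an instance with `opt ≤ s` and `deg_+(c − ℑ) > f(n)`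
  obtain ⟨I, hIs, hdeg⟩ := exists_nonnegDegree_gt_of_not_saAchieves hsc hSA
  -- Step 2: the block length `b`
  set b : ℕ := ⌈C * Real.logb 2 n⌉₊ + 1 with hb_def
  have hlog_nonneg : 0 ≤ Real.logb 2 n := Real.logb_nonneg one_lt_two hn1
  have hClog_nonneg : 0 ≤ C * Real.logb 2 n := mul_nonneg hC.le hlog_nonneg
  have hb1 : 1 ≤ b := by omega
  have hbC : C * Real.logb 2 n ≤ b := by
    rw [hb_def]; push_cast
    linarith [Nat.le_ceil (C * Real.logb 2 n)]
  have hb_le : (b : ℝ) ≤ C * Real.logb 2 n + 2 := by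
    rw [hb_def]; push_cast
    linarith [Nat.ceil_lt_add_one hClog_nonneg]
  -- Step 3: `N = n · 2^b ≤ n^H`
  have hnC : (2 : ℝ) ^ (Real.logb 2 n * C) = (n : ℝ) ^ C := by
    rw [Real.rpow_mul zero_le_two, Real.rpow_logb two_pos (by norm_num) hn_pos]
  have hN : n * 2 ^ b ≤ n ^ (⌈C⌉₊ + 3) := by
    have h2b : ((2 : ℝ) ^ b : ℝ) ≤ 4 * (n : ℝ) ^ C := by
      calc ((2 : ℝ) ^ b : ℝ) = (2 : ℝ) ^ (b : ℝ) := (Real.rpow_natCast 2 b).symm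
        _ ≤ (2 : ℝ) ^ (C * Real.logb 2 n + 2) := Real.rpow_le_rpow_of_exponent_le one_le_two hb_le
        _ = (2 : ℝ) ^ (Real.logb 2 n * C) * (2 : ℝ) ^ (2 : ℝ) := by
          rw [← Real.rpow_add two_pos, mul_comm C]
        _ = 4 * (n : ℝ) ^ C := by rw [hnC]; norm_num; ring
    have h4 : (4 : ℝ) ≤ (n : ℝ) ^ (2 : ℝ) := by
      rw [show (2 : ℝ) = ((2 : ℕ) : ℝ) by norm_num, Real.rpow_natCast]
      have : (2 : ℝ) ≤ n := by exact_mod_cast hn2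
      nlinarith
    have hreal : (n : ℝ) * 2 ^ b ≤ (n : ℝ) ^ (⌈C⌉₊ + 3) := by
      calc (n : ℝ) * 2 ^ b ≤ n * (4 * (n : ℝ) ^ C) := by gcongr
        _ = 4 * ((n : ℝ) ^ (1 : ℝ) * (n : ℝ) ^ C) := by rw [Real.rpow_one]; ring
        _ ≤ (n : ℝ) ^ (2 : ℝ) * ((n : ℝ) ^ (1 : ℝ) * (n : ℝ) ^ C) := by gcongr
        _ = (n : ℝ) ^ (C + 3) := by
          rw [← Real.rpow_add hn_pos, ← Real.rpow_add hn_pos]; ring_nf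
        _ ≤ (n : ℝ) ^ ((⌈C⌉₊ + 3 : ℕ) : ℝ) := by
          refine Real.rpow_le_rpow_of_exponent_le hn1 ?_
          push_cast; linarith [Nat.le_ceil C]
        _ = (n : ℝ) ^ (⌈C⌉₊ + 3) := Real.rpow_natCast _ _
    exact_mod_cast hreal
  -- Step 4: restrict `L` to `n · 2^b` variables; Lemma 7.1 gives a factorisation of `M^b_F`
  obtain ⟨F, hF⟩ : ∃ F : (Fin n → Bool) → ℝ, F = fun z => (c - 1 / n) - I.val z := ⟨_, rfl⟩
  have hfac : HasNonnegFactorization (ipPatternMatrix b F) (R + 1) := by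
    rw [hF]
    exact (hL.restrict (Fin.castLEEmb hN)).hasNonnegFactorization_ipPatternMatrix I hIs
  -- Step 5: normalise `F` to mean one
  have hF_nonneg : ∀ z, 0 ≤ F z := fun z => by rw [hF]; have := hIs z; dsimp only; linarith
  obtain ⟨μ, hμ⟩ : ∃ μ : ℝ, μ = cubeExpect F := ⟨_, rfl⟩
  have hμ_eq : μ = (c - 1 / n) - cubeExpect I.val := by rw [hμ, hF, cubeExpect_const_sub]
  have hEI_le : cubeExpect I.val ≤ s := cubeExpect_le_of_forall_le hIs
  have hEI_nonneg : 0 ≤ cubeExpect I.val := cubeExpect_nonneg I.val_nonneg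
  have hμ_pos : 0 < μ := by rw [hμ_eq]; linarith
  have hμ_le : μ ≤ 1 := by rw [hμ_eq]; linarith
  obtain ⟨f₀, hf₀⟩ : ∃ f₀ : (Fin n → Bool) → ℝ, f₀ = fun z => μ⁻¹ * F z := ⟨_, rfl⟩
  have hf₀_nonneg : ∀ z, 0 ≤ f₀ z := fun z => by
    rw [hf₀]; exact mul_nonneg (inv_nonneg.2 hμ_pos.le) (hF_nonneg z)
  have hf₀_exp : cubeExpect f₀ = 1 := by
    rw [hf₀, cubeExpect_const_mul, ← hμ, inv_mul_cancel₀ hμ_pos.ne']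
  obtain ⟨η, hη⟩ : ∃ η : ℝ, η = μ⁻¹ * (1 / n) := ⟨_, rfl⟩
  have hη_ge : 1 / (n : ℝ) ≤ η := by
    rw [hη]
    exact le_mul_of_one_le_left hinv_nonneg ((one_le_inv₀ hμ_pos).2 hμ_le)
  have hsum : (fun z => f₀ z + η) = fun z => μ⁻¹ * (c - I.val z) := by
    funext z; rw [hf₀, hη, hF]; ring
  have hdegp : ((f n : ℕ) : ℝ) + 1 ≤ (nonnegDegree fun z => f₀ z + η : ℝ) := by
    rw [hsum, nonnegDegree_const_mul (inv_pos.2 hμ_pos)]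
    exact_mod_cast hdeg
  have hdegf₀ : (cubeDegree f₀ : ℝ) ≤ k := by
    have hFdeg : HasDegreeLE k F := by
      rw [hF]; exact (HasDegreeLE.const k (c - 1 / n)).sub I.hasDegreeLE_val
    have : HasDegreeLE k f₀ := by rw [hf₀]; exact hFdeg.const_mul μ⁻¹
    exact_mod_cast cubeDegree_le_of_hasDegreeLE this
  have hfac₀ : HasNonnegFactorization (ipPatternMatrix b f₀) (R + 1) := by
    rw [hf₀, ipPatternMatrix_const_mul]
    exact hfac.const_mul (inv_nonneg.2 hμ_pos.le)
  -- Step 6: Theorem 1.10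
  refine h110 n hn1' f₀ hf₀_nonneg hf₀_exp η hη_ge b hb1 hbC (R + 1) ?_ hfac₀
  -- Step 7: `R + 1 < 2^{c₀ b (deg_+ − 8 deg)}`
  set d : ℕ := f n with hd
  have hd16 : (16 * k : ℝ) ≤ d := by exact_mod_cast hk
  have hcb : 0 ≤ c₀ * b := by positivity
  have hE : c₀ * b * ((d : ℝ) / 2 + 1) ≤
      c₀ * b * ((nonnegDegree (fun z => f₀ z + η) : ℝ) - 8 * cubeDegree f₀) := by
    apply mul_le_mul_of_nonneg_left _ hcb
    have hk0 : (0 : ℝ) ≤ cubeDegree f₀ := Nat.cast_nonneg _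
    linarith
  have hexp_le : Real.logb 2 n * (c₀ * C * ((d : ℝ) / 2 + 1)) ≤ c₀ * b * ((d : ℝ) / 2 + 1) := by
    have hd0 : (0 : ℝ) ≤ (d : ℝ) / 2 + 1 := by positivity
    have := mul_le_mul_of_nonneg_left hbC (mul_nonneg hc₀.le hd0)
    nlinarith
  have hpow : (n : ℝ) ^ (c₀ * C) * (n : ℝ) ^ (c₀ * C / 2 * d) ≤
      (2 : ℝ) ^ (c₀ * b * ((d : ℝ) / 2 + 1)) := by
    rw [← Real.rpow_add hn_pos]
    calc (n : ℝ) ^ (c₀ * C + c₀ * C / 2 * d)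
        = (2 : ℝ) ^ (Real.logb 2 n * (c₀ * C * ((d : ℝ) / 2 + 1))) := by
          rw [Real.rpow_mul zero_le_two, Real.rpow_logb two_pos (by norm_num) hn_pos]; ring_nf
      _ ≤ (2 : ℝ) ^ (c₀ * b * ((d : ℝ) / 2 + 1)) :=
          Real.rpow_le_rpow_of_exponent_le one_le_two hexp_le
  have hn_big : (2 : ℝ) < (n : ℝ) ^ (c₀ * C) := by
    have hlt : (2 : ℝ) ^ (1 / (c₀ * C)) < n := by
      calc (2 : ℝ) ^ (1 / (c₀ * C)) ≤ ⌈(2 : ℝ) ^ (1 / (c₀ * C))⌉₊ := Nat.le_ceil _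
        _ < ((⌈(2 : ℝ) ^ (1 / (c₀ * C))⌉₊ + 2 : ℕ) : ℝ) := by push_cast; linarith
        _ ≤ n := by exact_mod_cast hn
    calc (2 : ℝ) = ((2 : ℝ) ^ (1 / (c₀ * C))) ^ (c₀ * C) := by
          rw [← Real.rpow_mul zero_le_two, one_div_mul_cancel hcC.ne', Real.rpow_one]
      _ < (n : ℝ) ^ (c₀ * C) := Real.rpow_lt_rpow (by positivity) hlt hcC
  have hR' : (R : ℝ) ≤ (n : ℝ) ^ (c₀ * C / 2 * d) := by
    refine hR.trans (Real.rpow_le_rpow_of_exponent_le hn1 ?_)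
    have hd0 : (0 : ℝ) ≤ d := Nat.cast_nonneg _
    exact mul_le_mul_of_nonneg_right (min_le_left _ _) hd0
  have hX1 : (1 : ℝ) ≤ (n : ℝ) ^ (c₀ * C / 2 * d) := by
    simpa using Real.rpow_le_rpow_of_exponent_le hn1 (by positivity : (0:ℝ) ≤ c₀ * C / 2 * d)
  have hXpos : (0 : ℝ) < (n : ℝ) ^ (c₀ * C / 2 * d) := by positivity
  calc ((R + 1 : ℕ) : ℝ) = R + 1 := by push_cast; ring
    _ ≤ 2 * (n : ℝ) ^ (c₀ * C / 2 * d) := by linarith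
    _ < (n : ℝ) ^ (c₀ * C) * (n : ℝ) ^ (c₀ * C / 2 * d) := mul_lt_mul_of_pos_right hn_big hXpos
    _ ≤ (2 : ℝ) ^ (c₀ * b * ((d : ℝ) / 2 + 1)) := hpow
    _ ≤ (2 : ℝ) ^ (c₀ * b * ((nonnegDegree (fun z => f₀ z + η) : ℝ) - 8 * cubeDegree f₀)) :=
        Real.rpow_le_rpow_of_exponent_le one_le_two hE

end Literature.Combinatorics.Optimization

end
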